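import Literature.Computability.FineGrained.IPRenameAnnot
import HarnessLib

/-!
# The renaming machine of Impagliazzo–Paturi's Lemma 2, XV: the block table and the block sizes of a mask

Family `fine-grained` (trunk T-CPLX-FINE). Fifteenth file of the machine half of Impagliazzo–Paturi's Lemma 2: the block table
`wBT (btab P F)` (`IPRenameTables.lean`: for each nonempty block, for each of its `B`-variables
`z`, the forcing table `entries P F z` — pattern bits `patt` and renamed `A`-literals `aLits` of
every clause containing `z`) and the block-size digits for the `f`-vector odometer.

* `entPass` (one pass over the clauses for a `B`-variable `z`: `zLit`/`otherLit`/`useLit`/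
  `litEndE` classify each literal by comparison with `z` and dictionary lookup; `emitEntry`/
  `clauseEndE` write the entry of a clause containing `z`) with **`runs_entPass`**
  (`patt_true_eq`, `patt_false_eq`, `stL_eq`: the flags and the staged word are `patt` and
  `cbody (aLits …)`);
* `bvar` / `btBody` / `btBuild m` over the dictionary records (position counter wrapped at
  `m = bsz P` by `wrapB`, a blank after every full block and after a final partial one; size
  digits `szW` pushed per variable), **`runs_btBuild`** (`bt := btOut P F`, `szs := szW m |bList|`);
* the identification with the vendored tables: `chunks` (consecutive slices; `map_block_eq_chunks`:
  the nonempty blocks are the chunks of `bList`), `outS_chunks`, **`btOut_eq : btOut P F =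
  wBT (btab P F)`**, and **`szW_eq_chunks`** (the digits are the block sizes, last block first).

## References

* R. Impagliazzo, R. Paturi, *On the complexity of k-SAT*, J. Comput. System Sci. 62 (2001)
  367–375, doi:10.1006/jcss.2000.1727, Lemma 2 (p. 373) and its "Moreover" sentence (the
  reduction is computable within the stated time); pp. 371–372 (`G_x`, `Ψ`, `Θ_i`, `Φ_f`).
  (Not held; acquisition request acq-00143.)
* T. Nipkow, G. Klein, *Concrete Semantics with Isabelle/HOL*, Springer 2014, Ch. 7 (big-step
  reasoning about loops, as in `SymbolPrograms.lean`).
-/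

namespace Literature.Computability.FineGrained.IPRenameM

open _root_.Computability Complexity Complexity.ACom Sparsifier IPRename
open Compaction (uflag uflag_true uflag_false)

/-! ### The forcing table of a `B`-variable: programs -/

/-- The literal is on `z` itself: the clause contains `z`; its polarity decides which forcing
pattern it violates (`ft`: cannot force `z` true; `ff`: cannot force `z` false). [folklore] -/
def zLit : RProg :=
  setFlagG Γ'.blank (kr KR.fl) ;;
  (pop (kr KR.lpol) fun o => match o with
    | some (Γ'.bit true) => setFlagG Γ'.blank (kr KR.ff)
    | some _ => setFlagG Γ'.blank (kr KR.ft)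
    | none => skip) ;;
  clear (kr KR.ju)

/-- Use the dictionary record of a literal on another variable: an `A`-literal is staged (polarity,
then the rank token) on `s2`; a `B`-literal violates both patterns. [folklore] -/
def useLit : RProg :=
  pop (kr KR.key) fun o => match o with
    | some (Γ'.bit false) => (pop (kr KR.lpol) fun o' => match o' with
        | some q => push (kr KR.s2) q
        | none => skip) ;; loop (kr KR.key) (fun s => push (kr KR.s2) s)
    | some _ => clear (kr KR.key) ;; setFlagG Γ'.blank (kr KR.ft) ;; setFlagG Γ'.blank (kr KR.ff) ;; clear (kr KR.lpol)
    | none => clear (kr KR.lpol)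

/-- The literal is on another variable `u` (bits reversed in `ju`): look it up and use the record;
restore the probe of `z`. [folklore] -/
def otherLit : RProg :=
  clear (kr KR.pr) ;; copyToG (kr KR.ju) (kr KR.pr) (kr KR.t1) (kr KR.t2) ;; clear (kr KR.ju) ;; findRec KR.dict ;; clear (kr KR.fnd) ;; useLit ;;
  clear (kr KR.pr) ;; copyToG (kr KR.pr2) (kr KR.pr) (kr KR.t1) (kr KR.t2)

/-- At the comma closing a literal. [folklore] -/
def litEndE : RProg :=
  (eqW Γ'.blank).map embEq ;; pop (kr KR.ne) fun o => match o with
    | some _ => otherLit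
    | none => zLit

/-- Emit the entry of the clause: the two pattern bits, a comma, the staged literals in order, a
ket. [folklore] -/
def emitEntry : RProg :=
  (ifTop (kr KR.ft) fun o => match o with
    | some _ => push (kr KR.s5) (Γ'.bit false)
    | none => push (kr KR.s5) (Γ'.bit true)) ;;
  (ifTop (kr KR.ff) fun o => match o with
    | some _ => push (kr KR.s5) (Γ'.bit false)
    | none => push (kr KR.s5) (Γ'.bit true)) ;;
  push (kr KR.s5) Γ'.comma ;; pour (kr KR.s2) (kr KR.t1) ;; loop (kr KR.t1) (fun s => push (kr KR.s5) s) ;; push (kr KR.s5) Γ'.ket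

/-- At the ket closing a clause: emit its entry if it contains `z`; reset. [folklore] -/
def clauseEndE : RProg :=
  (pop (kr KR.fl) fun o => match o with
    | some _ => emitEntry
    | none => clear (kr KR.s2)) ;;
  clear (kr KR.ft) ;; clear (kr KR.ff)

/-- Body of the pass over the copy `s1` of the clauses for the `B`-variable `z` (mode `md` as in
`xBody`; the polarity of the current literal is kept in `lpol`). [folklore] -/
def entBody (s : Γ') : RProg :=
  pop (kr KR.md) fun o => match o, s with
    | none, Γ'.bit q => push (kr KR.lpol) (Γ'.bit q) ;; push (kr KR.md) Γ'.blank
    | none, Γ'.ket => clauseEndE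
    | none, _ => skip
    | some _, Γ'.bit d => push (kr KR.ex) (Γ'.bit d) ;; push (kr KR.ju) (Γ'.bit d) ;; push (kr KR.md) Γ'.blank
    | some _, Γ'.comma => litEndE
    | some _, _ => skip

/-- `entPass`: one pass over the clauses for the `B`-variable `z` (probe in `pr` and `pr2`),
appending (reversed) the words of the entries of `z` to `s5`. [folklore] -/
def entPass : RProg := copyToG (kr KR.fam) (kr KR.s1) (kr KR.t1) (kr KR.t2) ;; loop (kr KR.s1) entBody

/-- The store family `eSt` over a base store. [folklore] -/
def eSt (S : RStore) (s1 md ex ju lpol fl ft ff s2 s5 pr ne fnd key : List Γ') : RStore := fun r =>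
  if r = kr KR.s1 then s1 else if r = kr KR.md then md else if r = kr KR.ex then ex else if r = kr KR.ju then ju else if r = kr KR.lpol then lpol else if r = kr KR.fl then fl else if r = kr KR.ft then ft else if r = kr KR.ff then ff else if r = kr KR.s2 then s2 else if r = kr KR.s5 then s5 else if r = kr KR.pr then pr else if r = kr KR.ne then ne else if r = kr KR.fnd then fnd else if r = kr KR.key then key else S r

section EstLemmas

variable (S : RStore) (s1 md ex ju lpol fl ft ff s2 s5 pr ne fnd key w : List Γ')

/-- Reading `s1`. [folklore] -/
@[simp] theorem eSt_s1 : eSt S s1 md ex ju lpol fl ft ff s2 s5 pr ne fnd key (kr KR.s1) = s1 := by simp [eSt]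
/-- Reading `md`. [folklore] -/
@[simp] theorem eSt_md : eSt S s1 md ex ju lpol fl ft ff s2 s5 pr ne fnd key (kr KR.md) = md := by simp [eSt]
/-- Reading `ex`. [folklore] -/
@[simp] theorem eSt_ex : eSt S s1 md ex ju lpol fl ft ff s2 s5 pr ne fnd key (kr KR.ex) = ex := by simp [eSt]
/-- Reading `ju`. [folklore] -/
@[simp] theorem eSt_ju : eSt S s1 md ex ju lpol fl ft ff s2 s5 pr ne fnd key (kr KR.ju) = ju := by simp [eSt]
/-- Reading `lpol`. [folklore] -/
@[simp] theorem eSt_lpol : eSt S s1 md ex ju lpol fl ft ff s2 s5 pr ne fnd key (kr KR.lpol) = lpol := by simp [eSt]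
/-- Reading `fl`. [folklore] -/
@[simp] theorem eSt_fl : eSt S s1 md ex ju lpol fl ft ff s2 s5 pr ne fnd key (kr KR.fl) = fl := by simp [eSt]
/-- Reading `ft`. [folklore] -/
@[simp] theorem eSt_ft : eSt S s1 md ex ju lpol fl ft ff s2 s5 pr ne fnd key (kr KR.ft) = ft := by simp [eSt]
/-- Reading `ff`. [folklore] -/
@[simp] theorem eSt_ff : eSt S s1 md ex ju lpol fl ft ff s2 s5 pr ne fnd key (kr KR.ff) = ff := by simp [eSt]
/-- Reading `s2`. [folklore] -/
@[simp] theorem eSt_s2 : eSt S s1 md ex ju lpol fl ft ff s2 s5 pr ne fnd key (kr KR.s2) = s2 := by simp [eSt]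
/-- Reading `s5`. [folklore] -/
@[simp] theorem eSt_s5 : eSt S s1 md ex ju lpol fl ft ff s2 s5 pr ne fnd key (kr KR.s5) = s5 := by simp [eSt]
/-- Reading `pr`. [folklore] -/
@[simp] theorem eSt_pr : eSt S s1 md ex ju lpol fl ft ff s2 s5 pr ne fnd key (kr KR.pr) = pr := by simp [eSt]
/-- Reading `ne`. [folklore] -/
@[simp] theorem eSt_ne : eSt S s1 md ex ju lpol fl ft ff s2 s5 pr ne fnd key (kr KR.ne) = ne := by simp [eSt]
/-- Reading `fnd`. [folklore] -/
@[simp] theorem eSt_fnd : eSt S s1 md ex ju lpol fl ft ff s2 s5 pr ne fnd key (kr KR.fnd) = fnd := by simp [eSt]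
/-- Reading `key`. [folklore] -/
@[simp] theorem eSt_key : eSt S s1 md ex ju lpol fl ft ff s2 s5 pr ne fnd key (kr KR.key) = key := by simp [eSt]
/-- Reading any other register. [folklore] -/
theorem eSt_other {r : Reg} (h0 : r ≠ kr KR.s1) (h1 : r ≠ kr KR.md) (h2 : r ≠ kr KR.ex) (h3 : r ≠ kr KR.ju) (h4 : r ≠ kr KR.lpol) (h5 : r ≠ kr KR.fl) (h6 : r ≠ kr KR.ft) (h7 : r ≠ kr KR.ff) (h8 : r ≠ kr KR.s2) (h9 : r ≠ kr KR.s5) (h10 : r ≠ kr KR.pr) (h11 : r ≠ kr KR.ne) (h12 : r ≠ kr KR.fnd) (h13 : r ≠ kr KR.key) :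
    eSt S s1 md ex ju lpol fl ft ff s2 s5 pr ne fnd key r = S r := by simp [eSt, h0, h1, h2, h3, h4, h5, h6, h7, h8, h9, h10, h11, h12, h13]
/-- Reading `pr2`. [folklore] -/
@[simp] theorem eSt_pr2 : eSt S s1 md ex ju lpol fl ft ff s2 s5 pr ne fnd key (kr KR.pr2) = S (kr KR.pr2) := by simp [eSt]
/-- Reading `dict`. [folklore] -/
@[simp] theorem eSt_dict : eSt S s1 md ex ju lpol fl ft ff s2 s5 pr ne fnd key (kr KR.dict) = S (kr KR.dict) := by simp [eSt]
/-- Reading `fam`. [folklore] -/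
@[simp] theorem eSt_fam : eSt S s1 md ex ju lpol fl ft ff s2 s5 pr ne fnd key (kr KR.fam) = S (kr KR.fam) := by simp [eSt]
/-- Reading `t1`. [folklore] -/
@[simp] theorem eSt_t1 : eSt S s1 md ex ju lpol fl ft ff s2 s5 pr ne fnd key (kr KR.t1) = S (kr KR.t1) := by simp [eSt]
/-- Reading `t2`. [folklore] -/
@[simp] theorem eSt_t2 : eSt S s1 md ex ju lpol fl ft ff s2 s5 pr ne fnd key (kr KR.t2) = S (kr KR.t2) := by simp [eSt]
/-- Reading `x2`. [folklore] -/
@[simp] theorem eSt_x2 : eSt S s1 md ex ju lpol fl ft ff s2 s5 pr ne fnd key (kr KR.x2) = S (kr KR.x2) := by simp [eSt]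
/-- Reading `vw`. [folklore] -/
@[simp] theorem eSt_vw : eSt S s1 md ex ju lpol fl ft ff s2 s5 pr ne fnd key (kr KR.vw) = S (kr KR.vw) := by simp [eSt]
/-- Reading `eb`. [folklore] -/
@[simp] theorem eSt_eb : eSt S s1 md ex ju lpol fl ft ff s2 s5 pr ne fnd key (kr KR.eb) = S (kr KR.eb) := by simp [eSt]
/-- Reading `lmd`. [folklore] -/
@[simp] theorem eSt_lmd : eSt S s1 md ex ju lpol fl ft ff s2 s5 pr ne fnd key (kr KR.lmd) = S (kr KR.lmd) := by simp [eSt]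
/-- Reading `dict2`. [folklore] -/
@[simp] theorem eSt_dict2 : eSt S s1 md ex ju lpol fl ft ff s2 s5 pr ne fnd key (kr KR.dict2) = S (kr KR.dict2) := by simp [eSt]
/-- Updating `s1`. [folklore] -/
@[simp] theorem update_eSt_s1 : Function.update (eSt S s1 md ex ju lpol fl ft ff s2 s5 pr ne fnd key) (kr KR.s1) w = eSt S w md ex ju lpol fl ft ff s2 s5 pr ne fnd key := by
  funext r; by_cases h : r = kr KR.s1
  · subst h; simp
  · rw [Function.update_of_ne h]; simp [eSt, h]
/-- Updating `md`. [folklore] -/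
@[simp] theorem update_eSt_md : Function.update (eSt S s1 md ex ju lpol fl ft ff s2 s5 pr ne fnd key) (kr KR.md) w = eSt S s1 w ex ju lpol fl ft ff s2 s5 pr ne fnd key := by
  funext r; by_cases h : r = kr KR.md
  · subst h; simp
  · rw [Function.update_of_ne h]; simp [eSt, h]
/-- Updating `ex`. [folklore] -/
@[simp] theorem update_eSt_ex : Function.update (eSt S s1 md ex ju lpol fl ft ff s2 s5 pr ne fnd key) (kr KR.ex) w = eSt S s1 md w ju lpol fl ft ff s2 s5 pr ne fnd key := by
  funext r; by_cases h : r = kr KR.ex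
  · subst h; simp
  · rw [Function.update_of_ne h]; simp [eSt, h]
/-- Updating `ju`. [folklore] -/
@[simp] theorem update_eSt_ju : Function.update (eSt S s1 md ex ju lpol fl ft ff s2 s5 pr ne fnd key) (kr KR.ju) w = eSt S s1 md ex w lpol fl ft ff s2 s5 pr ne fnd key := by
  funext r; by_cases h : r = kr KR.ju
  · subst h; simp
  · rw [Function.update_of_ne h]; simp [eSt, h]
/-- Updating `lpol`. [folklore] -/
@[simp] theorem update_eSt_lpol : Function.update (eSt S s1 md ex ju lpol fl ft ff s2 s5 pr ne fnd key) (kr KR.lpol) w = eSt S s1 md ex ju w fl ft ff s2 s5 pr ne fnd key := by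
  funext r; by_cases h : r = kr KR.lpol
  · subst h; simp
  · rw [Function.update_of_ne h]; simp [eSt, h]
/-- Updating `fl`. [folklore] -/
@[simp] theorem update_eSt_fl : Function.update (eSt S s1 md ex ju lpol fl ft ff s2 s5 pr ne fnd key) (kr KR.fl) w = eSt S s1 md ex ju lpol w ft ff s2 s5 pr ne fnd key := by
  funext r; by_cases h : r = kr KR.fl
  · subst h; simp
  · rw [Function.update_of_ne h]; simp [eSt, h]
/-- Updating `ft`. [folklore] -/
@[simp] theorem update_eSt_ft : Function.update (eSt S s1 md ex ju lpol fl ft ff s2 s5 pr ne fnd key) (kr KR.ft) w = eSt S s1 md ex ju lpol fl w ff s2 s5 pr ne fnd key := by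
  funext r; by_cases h : r = kr KR.ft
  · subst h; simp
  · rw [Function.update_of_ne h]; simp [eSt, h]
/-- Updating `ff`. [folklore] -/
@[simp] theorem update_eSt_ff : Function.update (eSt S s1 md ex ju lpol fl ft ff s2 s5 pr ne fnd key) (kr KR.ff) w = eSt S s1 md ex ju lpol fl ft w s2 s5 pr ne fnd key := by
  funext r; by_cases h : r = kr KR.ff
  · subst h; simp
  · rw [Function.update_of_ne h]; simp [eSt, h]
/-- Updating `s2`. [folklore] -/
@[simp] theorem update_eSt_s2 : Function.update (eSt S s1 md ex ju lpol fl ft ff s2 s5 pr ne fnd key) (kr KR.s2) w = eSt S s1 md ex ju lpol fl ft ff w s5 pr ne fnd key := by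
  funext r; by_cases h : r = kr KR.s2
  · subst h; simp
  · rw [Function.update_of_ne h]; simp [eSt, h]
/-- Updating `s5`. [folklore] -/
@[simp] theorem update_eSt_s5 : Function.update (eSt S s1 md ex ju lpol fl ft ff s2 s5 pr ne fnd key) (kr KR.s5) w = eSt S s1 md ex ju lpol fl ft ff s2 w pr ne fnd key := by
  funext r; by_cases h : r = kr KR.s5
  · subst h; simp
  · rw [Function.update_of_ne h]; simp [eSt, h]
/-- Updating `pr`. [folklore] -/
@[simp] theorem update_eSt_pr : Function.update (eSt S s1 md ex ju lpol fl ft ff s2 s5 pr ne fnd key) (kr KR.pr) w = eSt S s1 md ex ju lpol fl ft ff s2 s5 w ne fnd key := by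
  funext r; by_cases h : r = kr KR.pr
  · subst h; simp
  · rw [Function.update_of_ne h]; simp [eSt, h]
/-- Updating `ne`. [folklore] -/
@[simp] theorem update_eSt_ne : Function.update (eSt S s1 md ex ju lpol fl ft ff s2 s5 pr ne fnd key) (kr KR.ne) w = eSt S s1 md ex ju lpol fl ft ff s2 s5 pr w fnd key := by
  funext r; by_cases h : r = kr KR.ne
  · subst h; simp
  · rw [Function.update_of_ne h]; simp [eSt, h]
/-- Updating `fnd`. [folklore] -/
@[simp] theorem update_eSt_fnd : Function.update (eSt S s1 md ex ju lpol fl ft ff s2 s5 pr ne fnd key) (kr KR.fnd) w = eSt S s1 md ex ju lpol fl ft ff s2 s5 pr ne w key := by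
  funext r; by_cases h : r = kr KR.fnd
  · subst h; simp
  · rw [Function.update_of_ne h]; simp [eSt, h]
/-- Updating `key`. [folklore] -/
@[simp] theorem update_eSt_key : Function.update (eSt S s1 md ex ju lpol fl ft ff s2 s5 pr ne fnd key) (kr KR.key) w = eSt S s1 md ex ju lpol fl ft ff s2 s5 pr ne fnd w := by
  funext r; by_cases h : r = kr KR.key
  · subst h; simp
  · rw [Function.update_of_ne h]; simp [eSt, h]

end EstLemmas

/-- Every store is a `eSt` over itself. [folklore] -/
theorem eSt_eta (R : RStore) : eSt R (R (kr KR.s1)) (R (kr KR.md)) (R (kr KR.ex)) (R (kr KR.ju)) (R (kr KR.lpol)) (R (kr KR.fl)) (R (kr KR.ft)) (R (kr KR.ff)) (R (kr KR.s2)) (R (kr KR.s5)) (R (kr KR.pr)) (R (kr KR.ne)) (R (kr KR.fnd)) (R (kr KR.key)) = R := by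
  funext r
  by_cases h0 : r = kr KR.s1; · subst h0; simp
  by_cases h1 : r = kr KR.md; · subst h1; simp
  by_cases h2 : r = kr KR.ex; · subst h2; simp
  by_cases h3 : r = kr KR.ju; · subst h3; simp
  by_cases h4 : r = kr KR.lpol; · subst h4; simp
  by_cases h5 : r = kr KR.fl; · subst h5; simp
  by_cases h6 : r = kr KR.ft; · subst h6; simp
  by_cases h7 : r = kr KR.ff; · subst h7; simp
  by_cases h8 : r = kr KR.s2; · subst h8; simp
  by_cases h9 : r = kr KR.s5; · subst h9; simp
  by_cases h10 : r = kr KR.pr; · subst h10; simp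
  by_cases h11 : r = kr KR.ne; · subst h11; simp
  by_cases h12 : r = kr KR.fnd; · subst h12; simp
  by_cases h13 : r = kr KR.key; · subst h13; simp
  rw [eSt_other _ _ _ _ _ _ _ _ _ _ _ _ _ _ _ h0 h1 h2 h3 h4 h5 h6 h7 h8 h9 h10 h11 h12 h13]

/-! ### The forcing table of a `B`-variable: the literal step -/

/-- What the pass needs of the base store. [folklore] -/
structure EBase (S : RStore) (P : Params) (F : List (List (ℕ × Bool))) (z : ℕ) : Prop where
  /-- the saved probe -/
  pr2 : S (kr KR.pr2) = rbits z
  /-- the dictionary -/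
  dict : S (kr KR.dict) = wRecs (dictRecs P F (occList F))
  /-- the clauses -/
  fam : S (kr KR.fam) = wFam F
  /-- scratch -/
  t1 : S (kr KR.t1) = []
  /-- scratch -/
  t2 : S (kr KR.t2) = []
  /-- scratch -/
  x2 : S (kr KR.x2) = []
  /-- scratch -/
  vw : S (kr KR.vw) = []
  /-- scratch -/
  eb : S (kr KR.eb) = []
  /-- scratch -/
  lmd : S (kr KR.lmd) = []
  /-- scratch -/
  dict2 : S (kr KR.dict2) = []

/-- The staged word of an `A`-literal `(u, q)`: its renamed literal; nothing for a `B`-literal.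
[folklore] -/
def stg (P : Params) (F : List (List (ℕ × Bool))) (u : ℕ) (q : Bool) : List Γ' :=
  if inB P F u then [] else KCNF.encodeLiteral (newIdxA P F u, q)

section ESpec

variable (S : RStore) (P : Params) (F : List (List (ℕ × Bool))) (z : ℕ) (hE : EBase S P F z)
include hE

omit hE in
/-- **`zLit`**: the literal is on `z` with polarity `q`. [folklore] -/
theorem runs_zLit (s1 s2 s5 pr : List Γ') (q h vt vf : Bool) (ju : List Γ') :
    Runs zLit (eSt S s1 [] [] ju [Γ'.bit q] (uflag h) (uflag vt) (uflag vf) s2 s5 pr [] [] [])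
      (eSt S s1 [] [] [] [] (uflag true) (uflag (vt || !q)) (uflag (vf || q)) s2 s5 pr [] [] []) (4 + (4 + 2) + (2 * ju.length + 1)) := by
  unfold zLit
  have h1 := runs_setFlagG Γ'.blank (kr KR.fl) (eSt S s1 [] [] ju [Γ'.bit q] (uflag h) (uflag vt) (uflag vf) s2 s5 pr [] [] []) (by cases h <;> simp)
  rw [update_eSt_fl, show [Γ'.blank] = uflag true from rfl] at h1
  have h2 : Runs (pop (kr KR.lpol) fun o => match o with
      | some (Γ'.bit true) => setFlagG Γ'.blank (kr KR.ff)
      | some _ => setFlagG Γ'.blank (kr KR.ft)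
      | none => skip) (eSt S s1 [] [] ju [Γ'.bit q] (uflag true) (uflag vt) (uflag vf) s2 s5 pr [] [] [])
      (eSt S s1 [] [] ju [] (uflag true) (uflag (vt || !q)) (uflag (vf || q)) s2 s5 pr [] [] []) (4 + 2) := by
    refine Runs.pop_cons (k := kr KR.lpol) (a := Γ'.bit q) (w := []) (by simp) ?_
    rw [update_eSt_lpol]
    cases q with
    | true =>
      have h := runs_setFlagG Γ'.blank (kr KR.ff) (eSt S s1 [] [] ju [] (uflag true) (uflag vt) (uflag vf) s2 s5 pr [] [] []) (by cases vf <;> simp)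
      rw [update_eSt_ff, show [Γ'.blank] = uflag true from rfl] at h
      refine h.of_eq ?_ le_rfl; simp
    | false =>
      have h := runs_setFlagG Γ'.blank (kr KR.ft) (eSt S s1 [] [] ju [] (uflag true) (uflag vt) (uflag vf) s2 s5 pr [] [] []) (by cases vt <;> simp)
      rw [update_eSt_ft, show [Γ'.blank] = uflag true from rfl] at h
      refine h.of_eq ?_ le_rfl; simp
  have h3 := runs_clear (kr KR.ju) (eSt S s1 [] [] ju [] (uflag true) (uflag (vt || !q)) (uflag (vf || q)) s2 s5 pr [] [] [])
  rw [eSt_ju, update_eSt_ju] at h3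
  exact (h1.seq (h2.seq h3)).mono (by omega)

omit hE in
/-- **`useLit`** after the lookup of `u ≠ z` (an occurring variable). [folklore] -/
theorem runs_useLit (u : ℕ) (q vt vf : Bool) (s1 s2 s5 pr fl : List Γ') :
    Runs useLit (eSt S s1 [] [] [] [Γ'.bit q] fl (uflag vt) (uflag vf) s2 s5 pr [] [] (dpay P F u))
      (eSt S s1 [] [] [] [] fl (uflag (vt || inB P F u)) (uflag (vf || inB P F u)) ((stg P F u q).reverse ++ s2) s5 pr [] [] [])
      (3 * (dpay P F u).length + 14) := by
  unfold useLit stg dpay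
  cases hB : inB P F u with
  | false =>
    simp only [Bool.false_eq_true, if_false, Bool.or_false]
    set pay := (encodeNat (newIdxA P F u)).map Γ'.bit ++ [Γ'.comma] with hpay
    refine (Runs.pop_cons (k := kr KR.key) (a := Γ'.bit false) (w := pay) (by simp) ?_).mono (show (3 + (3 * pay.length + 1)) + 2 ≤ _ by simp; omega)
    rw [update_eSt_key]
    have h1 : Runs (pop (kr KR.lpol) fun o' => match o' with
        | some qq => push (kr KR.s2) qq
        | none => skip) (eSt S s1 [] [] [] [Γ'.bit q] fl (uflag vt) (uflag vf) s2 s5 pr [] [] pay)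
        (eSt S s1 [] [] [] [] fl (uflag vt) (uflag vf) (Γ'.bit q :: s2) s5 pr [] [] pay) (1 + 2) := by
      refine Runs.pop_cons (k := kr KR.lpol) (a := Γ'.bit q) (w := []) (by simp) (Runs.push' ?_)
      rw [update_eSt_lpol, eSt_s2, update_eSt_s2]
    have h2 := runs_moveAll (a := kr KR.key) (b := kr KR.s2) (by simp) pay (eSt S s1 [] [] [] [] fl (uflag vt) (uflag vf) (Γ'.bit q :: s2) s5 pr [] [] pay) (by simp)
    rw [eSt_s2, update_eSt_key, update_eSt_s2] at h2
    refine (h1.seq h2).of_eq ?_ le_rfl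
    simp [hpay, encodeLiteral_eq, litBody, List.reverse_append]
  | true =>
    simp only [if_true, Bool.or_true, List.reverse_nil, List.nil_append]
    set pay := List.replicate (blockOf P F u) Γ'.ket ++ List.replicate (posIn P F u) Γ'.bra ++ [Γ'.comma] with hpay
    refine (Runs.pop_cons (k := kr KR.key) (a := Γ'.bit true) (w := pay) (by simp) ?_).mono (show ((2 * pay.length + 1) + (4 + (4 + 3))) + 2 ≤ _ by simp; omega)
    rw [update_eSt_key]
    have h1 := runs_clear (kr KR.key) (eSt S s1 [] [] [] [Γ'.bit q] fl (uflag vt) (uflag vf) s2 s5 pr [] [] pay)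
    rw [eSt_key, update_eSt_key] at h1
    have h2 := runs_setFlagG Γ'.blank (kr KR.ft) (eSt S s1 [] [] [] [Γ'.bit q] fl (uflag vt) (uflag vf) s2 s5 pr [] [] []) (by cases vt <;> simp)
    rw [update_eSt_ft, show [Γ'.blank] = uflag true from rfl] at h2
    have h3 := runs_setFlagG Γ'.blank (kr KR.ff) (eSt S s1 [] [] [] [Γ'.bit q] fl (uflag true) (uflag vf) s2 s5 pr [] [] []) (by cases vf <;> simp)
    rw [update_eSt_ff, show [Γ'.blank] = uflag true from rfl] at h3
    have h4 := runs_clear (kr KR.lpol) (eSt S s1 [] [] [] [Γ'.bit q] fl (uflag true) (uflag true) s2 s5 pr [] [] [])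
    rw [eSt_lpol, update_eSt_lpol] at h4
    exact (h1.seq (h2.seq (h3.seq h4))).mono (by simp)

/-- The cost of the step for a literal on another variable. [folklore] -/
def otherCost (a b Ld d : ℕ) : ℕ :=
  (2 * a + 1) + (10 * b + 3) + (2 * b + 1) + ((12 * b + 44) * Ld + 4) + 3 + (3 * d + 14) + (2 * b + 1) + (10 * a + 3)

/-- **`otherLit`**: the literal is on `u ≠ z`, an occurring variable. [folklore] -/
theorem runs_otherLit (u : ℕ) (hu : u ∈ occList F) (q vt vf : Bool) (s1 s2 s5 fl : List Γ') :
    Runs otherLit (eSt S s1 [] [] (rbits u) [Γ'.bit q] fl (uflag vt) (uflag vf) s2 s5 (rbits z) [] [] [])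
      (eSt S s1 [] [] [] [] fl (uflag (vt || inB P F u)) (uflag (vf || inB P F u)) ((stg P F u q).reverse ++ s2) s5 (rbits z) [] [] [])
      (otherCost (rbits z).length (rbits u).length (wRecs (dictRecs P F (occList F))).length (dpay P F u).length) := by
  unfold otherLit
  have h1 := runs_clear (kr KR.pr) (eSt S s1 [] [] (rbits u) [Γ'.bit q] fl (uflag vt) (uflag vf) s2 s5 (rbits z) [] [] [])
  rw [eSt_pr, update_eSt_pr] at h1
  have h2 := runs_copyToG (a := kr KR.ju) (b := kr KR.pr) (t₁ := kr KR.t1) (t₂ := kr KR.t2)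
    (by simp) (by simp) (by simp) (by simp) (by simp) (by simp) (eSt S s1 [] [] (rbits u) [Γ'.bit q] fl (uflag vt) (uflag vf) s2 s5 [] [] [] [])
    (by simp [hE.t1]) (by simp [hE.t2]) (by simp)
  rw [eSt_ju, update_eSt_pr] at h2
  have h3 := runs_clear (kr KR.ju) (eSt S s1 [] [] (rbits u) [Γ'.bit q] fl (uflag vt) (uflag vf) s2 s5 (rbits u) [] [] [])
  rw [eSt_ju, update_eSt_ju] at h3
  have h4 := runs_findRec' (eSt S s1 [] [] [] [Γ'.bit q] fl (uflag vt) (uflag vf) s2 s5 (rbits u) [] [] []) u KR.dict (by decide) (by decide) (by decide)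
    (by decide) (by decide) (by decide) (by decide) (by decide) (by decide) (by decide) (dictRecs P F (occList F)) (dictRecs_blank_free P F _)
    (by simp [hE.dict]) (by simp) (by rw [eSt_other] <;> simp [hE.x2]) (by simp [hE.t1]) (by simp [hE.t2]) (by rw [eSt_other] <;> simp [hE.dict2])
    (by rw [eSt_other] <;> simp [hE.vw]) (by simp) (by rw [eSt_other] <;> simp [hE.eb]) (by rw [eSt_other] <;> simp [hE.lmd]) (by simp) (by simp) (by simp)
  rw [dictRecs, recHas_map_key, recPay_map_key _ _ _ hu, decide_eq_true hu, update_eSt_fnd, update_eSt_key, ← dictRecs] at h4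
  have h5 := runs_clear (kr KR.fnd) (eSt S s1 [] [] [] [Γ'.bit q] fl (uflag vt) (uflag vf) s2 s5 (rbits u) [] (uflag true) (dpay P F u))
  rw [eSt_fnd, update_eSt_fnd] at h5
  have h6 := runs_useLit S P F u q vt vf s1 s2 s5 (rbits u) fl
  have h7 := runs_clear (kr KR.pr) (eSt S s1 [] [] [] [] fl (uflag (vt || inB P F u)) (uflag (vf || inB P F u)) ((stg P F u q).reverse ++ s2) s5 (rbits u) [] [] [])
  rw [eSt_pr, update_eSt_pr] at h7
  have h8 := runs_copyToG (a := kr KR.pr2) (b := kr KR.pr) (t₁ := kr KR.t1) (t₂ := kr KR.t2)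
    (by simp) (by simp) (by simp) (by simp) (by simp) (by simp)
    (eSt S s1 [] [] [] [] fl (uflag (vt || inB P F u)) (uflag (vf || inB P F u)) ((stg P F u q).reverse ++ s2) s5 [] [] [] []) (by simp [hE.t1]) (by simp [hE.t2]) (by simp)
  rw [eSt_pr2, hE.pr2, update_eSt_pr] at h8
  refine (h1.seq (h2.seq (h3.seq (h4.seq (h5.seq (h6.seq (h7.seq h8))))))).mono ?_
  unfold otherCost
  simp only [uflag_true, List.length_singleton]
  omega

/-- The cost of the literal step. [folklore] -/
def litECost (a b Ld d : ℕ) : ℕ := (12 * a + 2 * b + 12) + (otherCost a b Ld d + 2 * b + 12)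

/-- **Specification of the literal step** for the literal `(u, q)`. [folklore] -/
theorem runs_litEndE (u : ℕ) (hu : u ∈ occList F) (q h vt vf : Bool) (s1 s2 s5 : List Γ') :
    Runs litEndE (eSt S s1 [] (rbits u) (rbits u) [Γ'.bit q] (uflag h) (uflag vt) (uflag vf) s2 s5 (rbits z) [] [] [])
      (eSt S s1 [] [] [] [] (uflag (h || (u == z))) (uflag (vt || ((u == z && !q) || (u != z && inB P F u))))
        (uflag (vf || ((u == z && q) || (u != z && inB P F u)))) ((if u = z then [] else (stg P F u q).reverse) ++ s2) s5 (rbits z) [] [] [])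
      (litECost (rbits z).length (rbits u).length (wRecs (dictRecs P F (occList F))).length (dpay P F u).length) := by
  unfold litEndE
  have hEq := runs_eqW_map (tk := Γ'.blank) embEq_injective (eSt S s1 [] (rbits u) (rbits u) [Γ'.bit q] (uflag h) (uflag vt) (uflag vf) s2 s5 (rbits z) [] [] [])
    (u := rbits z) (v := rbits u) (by simp [embEq]) (by simp [embEq]) (by simp [embEq, hE.x2]) (by simp [embEq])
  have hfl : flagW Γ'.blank (rbits z ≠ rbits u) = flagW Γ'.blank (z ≠ u) := flagW_congr _ rbits_injective.ne_iff
  have h1 : Runs ((eqW Γ'.blank).map embEq) (eSt S s1 [] (rbits u) (rbits u) [Γ'.bit q] (uflag h) (uflag vt) (uflag vf) s2 s5 (rbits z) [] [] [])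
      (eSt S s1 [] [] (rbits u) [Γ'.bit q] (uflag h) (uflag vt) (uflag vf) s2 s5 (rbits z) (flagW Γ'.blank (z ≠ u)) [] []) (12 * (rbits z).length + 2 * (rbits u).length + 12) := by
    rw [hfl] at hEq
    refine hEq.of_eq ?_ le_rfl
    simp only [embEq]
    funext r
    by_cases h0 : r = kr KR.ne; · subst h0; simp
    rw [Function.update_of_ne h0]
    by_cases h1 : r = kr KR.x2; · subst h1; simp [hE.x2]
    rw [Function.update_of_ne h1]
    by_cases h2 : r = kr KR.ex; · subst h2; simp
    rw [Function.update_of_ne h2]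
    by_cases h3 : r = kr KR.pr; · subst h3; simp
    rw [Function.update_of_ne h3]
    simp [eSt, h0, h2, h3]
  by_cases hzu : z = u
  · subst hzu
    rw [flagW_false _ (by simp)] at h1
    have h2 := runs_zLit S s1 s2 s5 (rbits z) q h vt vf (rbits z)
    have h2' : Runs (pop (kr KR.ne) fun o => match o with
        | some _ => otherLit
        | none => zLit) (eSt S s1 [] [] (rbits z) [Γ'.bit q] (uflag h) (uflag vt) (uflag vf) s2 s5 (rbits z) [] [] [])
        (eSt S s1 [] [] [] [] (uflag true) (uflag (vt || !q)) (uflag (vf || q)) s2 s5 (rbits z) [] [] []) ((4 + (4 + 2) + (2 * (rbits z).length + 1)) + 2) :=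
      Runs.pop_nil (by simp) h2
    refine (h1.seq h2').of_eq ?_ ?_
    · simp
    · unfold litECost otherCost; omega
  · rw [flagW_true _ hzu] at h1
    have h2 := runs_otherLit S P F z hE u hu q vt vf s1 s2 s5 (uflag h)
    have h2' : Runs (pop (kr KR.ne) fun o => match o with
        | some _ => otherLit
        | none => zLit) (eSt S s1 [] [] (rbits u) [Γ'.bit q] (uflag h) (uflag vt) (uflag vf) s2 s5 (rbits z) [Γ'.blank] [] [])
        (eSt S s1 [] [] [] [] (uflag h) (uflag (vt || inB P F u)) (uflag (vf || inB P F u)) ((stg P F u q).reverse ++ s2) s5 (rbits z) [] [] [])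
        (otherCost (rbits z).length (rbits u).length (wRecs (dictRecs P F (occList F))).length (dpay P F u).length + 2) := by
      refine Runs.pop_cons (k := kr KR.ne) (a := Γ'.blank) (w := []) (by simp) ?_
      rw [update_eSt_ne]; exact h2
    refine (h1.seq h2').of_eq ?_ ?_
    · have hb : (u == z) = false := beq_eq_false_iff_ne.2 (Ne.symm hzu)
      have hb' : (u != z) = true := by simp [Ne.symm hzu]
      simp [hb, hb', Ne.symm hzu]
    · unfold litECost; omega

end ESpec

/-! ### The forcing table of a `B`-variable: the pass over the clauses -/

section EFun

variable (P : Params) (F : List (List (ℕ × Bool))) (z : ℕ)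

/-- The clause (so far) contains `z`. [folklore] -/
def hL (lits : List (ℕ × Bool)) : Bool := lits.any fun l => l.1 == z

/-- The clause (so far) cannot force `z` to `true`. [folklore] -/
def vtL (lits : List (ℕ × Bool)) : Bool := lits.any fun l => (l.1 == z && !l.2) || (l.1 != z && inB P F l.1)

/-- The clause (so far) cannot force `z` to `false`. [folklore] -/
def vfL (lits : List (ℕ × Bool)) : Bool := lits.any fun l => (l.1 == z && l.2) || (l.1 != z && inB P F l.1)

/-- The staged renamed `A`-literals (reversed). [folklore] -/
def stL (lits : List (ℕ × Bool)) (s2 : List Γ') : List Γ' :=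
  lits.foldl (fun acc l => (if l.1 = z then [] else (stg P F l.1 l.2).reverse) ++ acc) s2

/-- `stL` over a cons. [folklore] -/
theorem stL_cons (l : ℕ × Bool) (lits : List (ℕ × Bool)) (s2 : List Γ') :
    stL P F z (l :: lits) s2 = stL P F z lits ((if l.1 = z then [] else (stg P F l.1 l.2).reverse) ++ s2) := rfl

/-- The pattern flags are the negated violation flags. [folklore] -/
theorem patt_true_eq (c : List (ℕ × Bool)) : patt P F c z true = !vtL P F z c := by
  unfold patt vtL
  induction c with
  | nil => rfl
  | cons l c ih =>
    rw [List.all_cons, List.any_cons, ih, Bool.not_or]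
    congr 1
    rcases l with ⟨u, q⟩
    by_cases h : u = z
    · subst h; cases q <;> simp [bne]
    · have hne : (u != z) = true := by simp [h]
      have hbe : (u == z) = false := beq_eq_false_iff_ne.2 h
      cases q <;> simp [hne, hbe]

/-- The pattern flags are the negated violation flags. [folklore] -/
theorem patt_false_eq (c : List (ℕ × Bool)) : patt P F c z false = !vfL P F z c := by
  unfold patt vfL
  induction c with
  | nil => rfl
  | cons l c ih =>
    rw [List.all_cons, List.any_cons, ih, Bool.not_or]
    congr 1
    rcases l with ⟨u, q⟩
    by_cases h : u = z
    · subst h; cases q <;> simp [bne]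
    · have hne : (u != z) = true := by simp [h]
      have hbe : (u == z) = false := beq_eq_false_iff_ne.2 h
      cases q <;> simp [hne, hbe]

/-- The staged word is the clause body of the renamed `A`-literals. [folklore] -/
theorem stL_eq : ∀ (lits : List (ℕ × Bool)) (s2 : List Γ'), stL P F z lits s2 = (cbody (aLits P F lits z)).reverse ++ s2
  | [], s2 => by simp [stL, aLits, cbody]
  | l :: lits, s2 => by
    rw [stL_cons, stL_eq lits]
    have ha : aLits P F (l :: lits) z = (if (l.1 != z && !inB P F l.1) = true then [(newIdxA P F l.1, l.2)] else []) ++ aLits P F lits z := by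
      unfold aLits; rw [List.filter_cons]; split_ifs <;> simp
    rw [ha]
    unfold stg
    by_cases h : l.1 = z
    · simp [h, cbody]
    · cases hb : inB P F l.1
      · have hc : (l.1 != z && !false) = true := by simp [h]
        rw [if_pos hc, if_neg h]
        simp [cbody, List.reverse_append]
      · have hc : ¬ (l.1 != z && !true) = true := by simp
        rw [if_neg hc, if_neg h]
        simp [cbody]

/-- `hL` is `occursIn`. [folklore] -/
theorem hL_eq (c : List (ℕ × Bool)) : hL z c = occursIn z c := rfl

end EFun

/-- The per-symbol budget of the pass for a `B`-variable. [folklore] -/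
def eK (Lo Ld m : ℕ) : ℕ := (12 * Lo + 44) * Ld + 45 * Lo + 3 * m + 80

section ESpec2

variable (S : RStore) (P : Params) (F : List (List (ℕ × Bool))) (z : ℕ) (hE : EBase S P F z)
  (Lo : ℕ) (hLo : (wRecs (ocRecs F P.cap (occList F))).length ≤ Lo) (hz : z ∈ occList F)
include hE hLo hz

omit hE hLo hz in
/-- Index bits go to `ex` and `ju` (mode `blank`). [folklore] -/
theorem segRuns_e_bits (lpol fl ft ff s2 s5 pr : List Γ') : ∀ (u : List Bool) (rest ex ju : List Γ'),
    SegRuns (kr KR.s1) entBody (u.map Γ'.bit) (eSt S (u.map Γ'.bit ++ rest) [Γ'.blank] ex ju lpol fl ft ff s2 s5 pr [] [] [])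
      (eSt S rest [Γ'.blank] ((u.map Γ'.bit).reverse ++ ex) ((u.map Γ'.bit).reverse ++ ju) lpol fl ft ff s2 s5 pr [] [] []) (7 * u.length)
  | [], rest, ex, ju => by simpa using SegRuns.nil (kr KR.s1) entBody _
  | d :: u, rest, ex, ju => by
    have hbody : Runs (entBody (Γ'.bit d)) (Function.update (eSt S (Γ'.bit d :: (u.map Γ'.bit ++ rest)) [Γ'.blank] ex ju lpol fl ft ff s2 s5 pr [] [] [])
        (kr KR.s1) (u.map Γ'.bit ++ rest)) (eSt S (u.map Γ'.bit ++ rest) [Γ'.blank] (Γ'.bit d :: ex) (Γ'.bit d :: ju) lpol fl ft ff s2 s5 pr [] [] []) (3 + 2) := by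
      rw [update_eSt_s1]; unfold entBody
      refine Runs.pop_cons (k := kr KR.md) (a := Γ'.blank) (w := []) (by simp) ?_
      rw [update_eSt_md]
      refine ((Runs.push' (R' := eSt S (u.map Γ'.bit ++ rest) [] (Γ'.bit d :: ex) ju lpol fl ft ff s2 s5 pr [] [] []) (by simp)).seq
        ((Runs.push' (R' := eSt S (u.map Γ'.bit ++ rest) [] (Γ'.bit d :: ex) (Γ'.bit d :: ju) lpol fl ft ff s2 s5 pr [] [] []) (by simp)).seq
        (Runs.push' (by simp)))).of_eq rfl (by norm_num)
    have ih := segRuns_e_bits lpol fl ft ff s2 s5 pr u rest (Γ'.bit d :: ex) (Γ'.bit d :: ju)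
    have hk : eSt S (Γ'.bit d :: (u.map Γ'.bit ++ rest)) [Γ'.blank] ex ju lpol fl ft ff s2 s5 pr [] [] [] (kr KR.s1) = Γ'.bit d :: (u.map Γ'.bit ++ rest) := by simp
    refine (SegRuns.cons hk hbody ih).cast (by simp) (by simp) (by simp) ?_
    simp only [List.length_cons]; omega

omit hE hz in
/-- Index tokens of occurring variables are at most `Lo` long. [folklore] -/
theorem rbits_le_of_mem {x : ℕ} (hx : x ∈ occList F) : (rbits x).length ≤ Lo := by
  refine le_trans ?_ hLo
  obtain ⟨s₁, s₂, hs⟩ := List.append_of_mem hx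
  unfold wRecs ocRecs; rw [hs]
  simp only [List.map_append, List.map_cons, List.flatMap_append, List.flatMap_cons, List.length_append, List.length_cons, List.length_map, rbits,
    List.length_reverse]
  omega

omit hE hz in
/-- Dictionary payloads are at most `Lo + m + 2` long. [folklore] -/
theorem length_dpay_le (x : ℕ) : (dpay P F x).length ≤ Lo + bsz P + 2 := by
  have hocc : (occList F).length ≤ Lo := (length_le_wRecs F P.cap (occList F)).trans hLo
  unfold dpay
  split_ifs with hB
  · have hi : blockOf P F x ≤ Lo := by
      unfold blockOf
      refine (Nat.div_le_self _ _).trans ((List.idxOf_le_length).trans ?_)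
      exact (List.length_filter_le _ _).trans hocc
    have hj : posIn P F x < bsz P := Nat.mod_lt _ (bsz_pos P)
    simp only [List.length_cons, List.length_append, List.length_replicate, List.length_nil]; omega
  · have ha : (encodeNat (newIdxA P F x)).length ≤ Lo := by
      refine (TokConv.length_encodeNat_le _).trans ?_
      unfold newIdxA
      exact (List.idxOf_le_length).trans ((List.length_filter_le _ _).trans hocc)
    simp only [List.length_cons, List.length_append, List.length_map, List.length_nil]; omega

omit hE hz in
/-- Staged words are at most `Lo + 2` long. [folklore] -/
theorem length_stg_le (x : ℕ) (q : Bool) : (stg P F x q).length ≤ Lo + 2 := by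
  have hocc : (occList F).length ≤ Lo := (length_le_wRecs F P.cap (occList F)).trans hLo
  unfold stg
  split_ifs
  · simp
  · have ha : (encodeNat (newIdxA P F x)).length ≤ Lo := by
      refine (TokConv.length_encodeNat_le _).trans ?_
      unfold newIdxA
      exact (List.idxOf_le_length).trans ((List.length_filter_le _ _).trans hocc)
    simp [encodeLiteral_eq, litBody]; omega

/-- **One literal** `(u, q)`. [folklore] -/
theorem segRuns_e_literal (u : ℕ) (q : Bool) (hu : u ∈ occList F) (h vt vf : Bool) (s2 s5 rest : List Γ') :
    SegRuns (kr KR.s1) entBody (KCNF.encodeLiteral (u, q)) (eSt S (KCNF.encodeLiteral (u, q) ++ rest) [] [] [] [] (uflag h) (uflag vt) (uflag vf) s2 s5 (rbits z) [] [] [])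
      (eSt S rest [] [] [] [] (uflag (h || (u == z))) (uflag (vt || ((u == z && !q) || (u != z && inB P F u))))
        (uflag (vf || ((u == z && q) || (u != z && inB P F u)))) ((if u = z then [] else (stg P F u q).reverse) ++ s2) s5 (rbits z) [] [] [])
      (eK Lo (wRecs (dictRecs P F (occList F))).length (bsz P) * (KCNF.encodeLiteral (u, q)).length) := by
  have hzL := rbits_le_of_mem P F Lo hLo hz
  have huL := rbits_le_of_mem P F Lo hLo hu
  have hdL := length_dpay_le P F Lo hLo u
  have hlit : KCNF.encodeLiteral (u, q) = Γ'.bit q :: ((encodeNat u).map Γ'.bit ++ [Γ'.comma]) := rfl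
  rw [hlit]
  set bs := (encodeNat u).map Γ'.bit with hbs
  have hrb : bs.reverse = rbits u := rfl
  have h1 : Runs (entBody (Γ'.bit q)) (Function.update (eSt S (Γ'.bit q :: (bs ++ [Γ'.comma]) ++ rest) [] [] [] [] (uflag h) (uflag vt) (uflag vf) s2 s5 (rbits z) [] [] [])
      (kr KR.s1) (bs ++ [Γ'.comma] ++ rest)) (eSt S (bs ++ [Γ'.comma] ++ rest) [Γ'.blank] [] [] [Γ'.bit q] (uflag h) (uflag vt) (uflag vf) s2 s5 (rbits z) [] [] []) ((1 + 1) + 2) := by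
    rw [update_eSt_s1]; unfold entBody
    refine Runs.pop_nil (by simp) ?_
    exact (Runs.push' (R' := eSt S (bs ++ [Γ'.comma] ++ rest) [] [] [] [Γ'.bit q] (uflag h) (uflag vt) (uflag vf) s2 s5 (rbits z) [] [] []) (by simp)).seq
      (Runs.push' (by simp))
  have h2 := segRuns_e_bits S [Γ'.bit q] (uflag h) (uflag vt) (uflag vf) s2 s5 (rbits z) (encodeNat u) ([Γ'.comma] ++ rest) [] []
  rw [← hbs] at h2
  simp only [List.append_nil] at h2
  rw [hrb] at h2
  have h3 : Runs (entBody Γ'.comma) (Function.update (eSt S ([Γ'.comma] ++ rest) [Γ'.blank] (rbits u) (rbits u) [Γ'.bit q] (uflag h) (uflag vt) (uflag vf) s2 s5 (rbits z) [] [] [])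
      (kr KR.s1) rest)
      (eSt S rest [] [] [] [] (uflag (h || (u == z))) (uflag (vt || ((u == z && !q) || (u != z && inB P F u))))
        (uflag (vf || ((u == z && q) || (u != z && inB P F u)))) ((if u = z then [] else (stg P F u q).reverse) ++ s2) s5 (rbits z) [] [] [])
      (litECost (rbits z).length (rbits u).length (wRecs (dictRecs P F (occList F))).length (dpay P F u).length + 2) := by
    rw [update_eSt_s1]; unfold entBody
    refine Runs.pop_cons (k := kr KR.md) (a := Γ'.blank) (w := []) (by simp) ?_
    rw [update_eSt_md]
    exact runs_litEndE S P F z hE u hu q h vt vf rest s2 s5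
  have hk1 : eSt S (Γ'.bit q :: (bs ++ [Γ'.comma]) ++ rest) [] [] [] [] (uflag h) (uflag vt) (uflag vf) s2 s5 (rbits z) [] [] [] (kr KR.s1) = Γ'.bit q :: (bs ++ [Γ'.comma] ++ rest) := by
    simp
  have hk3 : eSt S ([Γ'.comma] ++ rest) [Γ'.blank] (rbits u) (rbits u) [Γ'.bit q] (uflag h) (uflag vt) (uflag vf) s2 s5 (rbits z) [] [] [] (kr KR.s1) = Γ'.comma :: rest := by
    simp
  have h23 := h2.append (SegRuns.single hk3 h3)
  have := SegRuns.cons hk1 h1 (h23.cast rfl (by simp) rfl le_rfl)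
  refine this.cast (by simp) rfl rfl ?_
  have hbl : (encodeNat u).length = (rbits u).length := by simp [rbits]
  set Ld := (wRecs (dictRecs P F (occList F))).length
  simp only [List.length_cons, List.length_append, List.length_nil, hbl, eK, litECost, otherCost]
  nlinarith [Nat.zero_le ((rbits u).length * Ld), Nat.zero_le (Lo * Ld), huL, hzL, hdL, Nat.zero_le Ld]

/-- **The literals of a clause.** [folklore] -/
theorem segRuns_e_lits : ∀ (lits : List (ℕ × Bool)), (∀ l ∈ lits, l.1 ∈ occList F) → ∀ (h vt vf : Bool) (s2 s5 rest : List Γ'),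
    SegRuns (kr KR.s1) entBody (cbody lits) (eSt S (cbody lits ++ rest) [] [] [] [] (uflag h) (uflag vt) (uflag vf) s2 s5 (rbits z) [] [] [])
      (eSt S rest [] [] [] [] (uflag (h || hL z lits)) (uflag (vt || vtL P F z lits)) (uflag (vf || vfL P F z lits)) (stL P F z lits s2) s5 (rbits z) [] [] [])
      (eK Lo (wRecs (dictRecs P F (occList F))).length (bsz P) * (cbody lits).length)
  | [], _, h, vt, vf, s2, s5, rest => by simpa [hL, vtL, vfL, stL] using SegRuns.nil (kr KR.s1) entBody _
  | l :: lits, hl, h, vt, vf, s2, s5, rest => by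
    have h1 := segRuns_e_literal S P F z hE Lo hLo hz l.1 l.2 (hl l (by simp)) h vt vf s2 s5 (cbody lits ++ rest)
    have h2 := segRuns_e_lits lits (fun l' h => hl l' (by simp [h])) (h || (l.1 == z)) (vt || ((l.1 == z && !l.2) || (l.1 != z && inB P F l.1)))
      (vf || ((l.1 == z && l.2) || (l.1 != z && inB P F l.1))) ((if l.1 = z then [] else (stg P F l.1 l.2).reverse) ++ s2) s5 rest
    have := h1.append h2
    refine this.cast (by simp [cbody_cons, encodeLiteral_eq]) (by simp [cbody_cons, encodeLiteral_eq]) ?_ ?_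
    · simp [hL, vtL, vfL, stL_cons, Bool.or_assoc]
    · simp only [cbody_cons, encodeLiteral_eq, List.length_append, List.length_cons, List.length_nil]; ring_nf; omega

omit hE hLo hz in
/-- **`emitEntry`.** [folklore] -/
theorem runs_emitEntry (s1 s5 pr : List Γ') (vt vf : Bool) (s2 : List Γ') (ht1 : S (kr KR.t1) = []) :
    Runs emitEntry (eSt S s1 [] [] [] [] [] (uflag vt) (uflag vf) s2 s5 pr [] [] [])
      (eSt S s1 [] [] [] [] [] (uflag vt) (uflag vf) [] (Γ'.ket :: (s2 ++ Γ'.comma :: Γ'.bit (!vf) :: Γ'.bit (!vt) :: s5)) pr [] [] []) (6 * s2.length + 12) := by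
  unfold emitEntry
  have h1 : Runs (ifTop (kr KR.ft) fun o => match o with
      | some _ => push (kr KR.s5) (Γ'.bit false)
      | none => push (kr KR.s5) (Γ'.bit true)) (eSt S s1 [] [] [] [] [] (uflag vt) (uflag vf) s2 s5 pr [] [] [])
      (eSt S s1 [] [] [] [] [] (uflag vt) (uflag vf) s2 (Γ'.bit (!vt) :: s5) pr [] [] []) 4 := by
    cases vt with
    | true => exact Runs.ifTop_cons (R := eSt S s1 [] [] [] [] [] (uflag true) (uflag vf) s2 s5 pr [] [] []) (x := Γ'.blank) (w := []) (by simp) (Runs.push' (by simp))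
    | false => exact (Runs.ifTop_nil (R := eSt S s1 [] [] [] [] [] (uflag false) (uflag vf) s2 s5 pr [] [] []) (by simp) (Runs.push' (by simp))).mono (by norm_num)
  have h2 : Runs (ifTop (kr KR.ff) fun o => match o with
      | some _ => push (kr KR.s5) (Γ'.bit false)
      | none => push (kr KR.s5) (Γ'.bit true)) (eSt S s1 [] [] [] [] [] (uflag vt) (uflag vf) s2 (Γ'.bit (!vt) :: s5) pr [] [] [])
      (eSt S s1 [] [] [] [] [] (uflag vt) (uflag vf) s2 (Γ'.bit (!vf) :: Γ'.bit (!vt) :: s5) pr [] [] []) 4 := by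
    cases vf with
    | true => exact Runs.ifTop_cons (R := eSt S s1 [] [] [] [] [] (uflag vt) (uflag true) s2 (Γ'.bit (!vt) :: s5) pr [] [] []) (x := Γ'.blank) (w := []) (by simp) (Runs.push' (by simp))
    | false => exact (Runs.ifTop_nil (R := eSt S s1 [] [] [] [] [] (uflag vt) (uflag false) s2 (Γ'.bit (!vt) :: s5) pr [] [] []) (by simp) (Runs.push' (by simp))).mono (by norm_num)
  have h3 : Runs (push (kr KR.s5) Γ'.comma) (eSt S s1 [] [] [] [] [] (uflag vt) (uflag vf) s2 (Γ'.bit (!vf) :: Γ'.bit (!vt) :: s5) pr [] [] [])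
      (eSt S s1 [] [] [] [] [] (uflag vt) (uflag vf) s2 (Γ'.comma :: Γ'.bit (!vf) :: Γ'.bit (!vt) :: s5) pr [] [] []) 1 := Runs.push' (by simp)
  have h4 := runs_pour (a := kr KR.s2) (b := kr KR.t1) (by simp) (eSt S s1 [] [] [] [] [] (uflag vt) (uflag vf) s2 (Γ'.comma :: Γ'.bit (!vf) :: Γ'.bit (!vt) :: s5) pr [] [] [])
  rw [eSt_s2, eSt_t1, ht1, List.append_nil, update_eSt_s2] at h4
  set X4 := Function.update (eSt S s1 [] [] [] [] [] (uflag vt) (uflag vf) [] (Γ'.comma :: Γ'.bit (!vf) :: Γ'.bit (!vt) :: s5) pr [] [] []) (kr KR.t1) s2.reverse with hX4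
  have h5 := runs_moveAll (a := kr KR.t1) (b := kr KR.s5) (by simp) s2.reverse X4 (by simp [hX4])
  have e5 : X4 (kr KR.s5) = Γ'.comma :: Γ'.bit (!vf) :: Γ'.bit (!vt) :: s5 := by simp [hX4]
  rw [e5, List.reverse_reverse, List.length_reverse] at h5
  have e5' : Function.update (Function.update X4 (kr KR.t1) []) (kr KR.s5) (s2 ++ Γ'.comma :: Γ'.bit (!vf) :: Γ'.bit (!vt) :: s5) =
      eSt S s1 [] [] [] [] [] (uflag vt) (uflag vf) [] (s2 ++ Γ'.comma :: Γ'.bit (!vf) :: Γ'.bit (!vt) :: s5) pr [] [] [] := by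
    have et : Function.update X4 (kr KR.t1) [] = eSt S s1 [] [] [] [] [] (uflag vt) (uflag vf) [] (Γ'.comma :: Γ'.bit (!vf) :: Γ'.bit (!vt) :: s5) pr [] [] [] := by
      rw [hX4, Function.update_idem]; exact Function.update_eq_self_iff.2 (by simp [ht1])
    rw [et, update_eSt_s5]
  rw [e5'] at h5
  have h6 : Runs (push (kr KR.s5) Γ'.ket) (eSt S s1 [] [] [] [] [] (uflag vt) (uflag vf) [] (s2 ++ Γ'.comma :: Γ'.bit (!vf) :: Γ'.bit (!vt) :: s5) pr [] [] [])
      (eSt S s1 [] [] [] [] [] (uflag vt) (uflag vf) [] (Γ'.ket :: (s2 ++ Γ'.comma :: Γ'.bit (!vf) :: Γ'.bit (!vt) :: s5)) pr [] [] []) 1 := Runs.push' (by simp)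
  exact (h1.seq (h2.seq (h3.seq (h4.seq (h5.seq h6))))).of_eq rfl (by omega)

omit hE hLo hz in
/-- **`clauseEndE`.** [folklore] -/
theorem runs_clauseEndE (s1 s5 pr : List Γ') (h vt vf : Bool) (s2 : List Γ') (ht1 : S (kr KR.t1) = []) :
    Runs clauseEndE (eSt S s1 [] [] [] [] (uflag h) (uflag vt) (uflag vf) s2 s5 pr [] [] [])
      (eSt S s1 [] [] [] [] [] [] [] [] (if h then Γ'.ket :: (s2 ++ Γ'.comma :: Γ'.bit (!vf) :: Γ'.bit (!vt) :: s5) else s5) pr [] [] []) (6 * s2.length + 22) := by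
  unfold clauseEndE
  have hc : ∀ (b5 : List Γ'), Runs (clear (kr KR.ft) ;; clear (kr KR.ff)) (eSt S s1 [] [] [] [] [] (uflag vt) (uflag vf) [] b5 pr [] [] [])
      (eSt S s1 [] [] [] [] [] [] [] [] b5 pr [] [] []) ((2 * (uflag vt).length + 1) + (2 * (uflag vf).length + 1)) := by
    intro b5
    have h1 := runs_clear (kr KR.ft) (eSt S s1 [] [] [] [] [] (uflag vt) (uflag vf) [] b5 pr [] [] [])
    rw [eSt_ft, update_eSt_ft] at h1
    have h2 := runs_clear (kr KR.ff) (eSt S s1 [] [] [] [] [] [] (uflag vf) [] b5 pr [] [] [])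
    rw [eSt_ff, update_eSt_ff] at h2
    exact h1.seq h2
  have hfl : (uflag vt).length ≤ 1 ∧ (uflag vf).length ≤ 1 := ⟨by cases vt <;> simp, by cases vf <;> simp⟩
  cases h with
  | true =>
    rw [if_pos rfl]
    have he := runs_emitEntry S s1 s5 pr vt vf s2 ht1
    have h1 : Runs (pop (kr KR.fl) fun o => match o with
        | some _ => emitEntry
        | none => clear (kr KR.s2)) (eSt S s1 [] [] [] [] (uflag true) (uflag vt) (uflag vf) s2 s5 pr [] [] [])
        (eSt S s1 [] [] [] [] [] (uflag vt) (uflag vf) [] (Γ'.ket :: (s2 ++ Γ'.comma :: Γ'.bit (!vf) :: Γ'.bit (!vt) :: s5)) pr [] [] []) ((6 * s2.length + 12) + 2) := by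
      refine Runs.pop_cons (k := kr KR.fl) (a := Γ'.blank) (w := []) (by simp) ?_
      rw [update_eSt_fl]; exact he
    exact (h1.seq (hc _)).mono (by omega)
  | false =>
    simp only [Bool.false_eq_true, if_false]
    have h0 := runs_clear (kr KR.s2) (eSt S s1 [] [] [] [] (uflag false) (uflag vt) (uflag vf) s2 s5 pr [] [] [])
    rw [eSt_s2, update_eSt_s2] at h0
    have h1 : Runs (pop (kr KR.fl) fun o => match o with
        | some _ => emitEntry
        | none => clear (kr KR.s2)) (eSt S s1 [] [] [] [] (uflag false) (uflag vt) (uflag vf) s2 s5 pr [] [] [])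
        (eSt S s1 [] [] [] [] [] (uflag vt) (uflag vf) [] s5 pr [] [] []) ((2 * s2.length + 1) + 2) :=
      Runs.pop_nil (by simp) (h0.of_eq (by simp) le_rfl)
    exact (h1.seq (hc _)).mono (by omega)

omit hE hLo hz in
/-- The staged register grows by at most `Lo + 2` per literal. [folklore] -/
theorem length_stL_le (hLo' : (wRecs (ocRecs F P.cap (occList F))).length ≤ Lo) : ∀ (lits : List (ℕ × Bool)) (s2 : List Γ'),
    (stL P F z lits s2).length ≤ s2.length + (Lo + 2) * lits.length
  | [], s2 => by simp [stL]
  | l :: lits, s2 => by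
    rw [stL_cons]
    refine (length_stL_le hLo' lits _).trans ?_
    have := length_stg_le P F Lo hLo' l.1 l.2
    split_ifs <;> simp only [List.length_append, List.length_reverse, List.length_nil, List.length_cons] <;> nlinarith

/-- The per-symbol budget of a clause of the pass. [folklore] -/
def cKe (Lo Ld m : ℕ) : ℕ := eK Lo Ld m + 6 * Lo + 40

/-- The word contributed by a clause to the forcing table of `z`. [folklore] -/
def entWc (P : Params) (F : List (List (ℕ × Bool))) (z : ℕ) (c : List (ℕ × Bool)) : List Γ' :=
  if occursIn z c then wEntry (entryOf P F c z) else []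

/-- **One clause.** [folklore] -/
theorem segRuns_e_clause (c : List (ℕ × Bool)) (hc : ∀ l ∈ c, l.1 ∈ occList F) (s5 rest : List Γ') :
    SegRuns (kr KR.s1) entBody (KCNF.encodeClause c) (eSt S (KCNF.encodeClause c ++ rest) [] [] [] [] [] [] [] [] s5 (rbits z) [] [] [])
      (eSt S rest [] [] [] [] [] [] [] [] ((entWc P F z c).reverse ++ s5) (rbits z) [] [] [])
      (cKe Lo (wRecs (dictRecs P F (occList F))).length (bsz P) * (KCNF.encodeClause c).length) := by
  have hw : KCNF.encodeClause c = Γ'.bra :: (cbody c ++ [Γ'.ket]) := by simp [KCNF.encodeClause, cbody]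
  rw [hw]
  have h0 : Runs (entBody Γ'.bra) (Function.update (eSt S (Γ'.bra :: (cbody c ++ [Γ'.ket]) ++ rest) [] [] [] [] [] [] [] [] s5 (rbits z) [] [] []) (kr KR.s1) (cbody c ++ [Γ'.ket] ++ rest))
      (eSt S (cbody c ++ [Γ'.ket] ++ rest) [] [] [] [] [] [] [] [] s5 (rbits z) [] [] []) (0 + 2) := by
    rw [update_eSt_s1]; unfold entBody
    exact Runs.pop_nil (by simp) ((Runs.skip _).of_eq (by simp) le_rfl)
  have hk0 : eSt S (Γ'.bra :: (cbody c ++ [Γ'.ket]) ++ rest) [] [] [] [] [] [] [] [] s5 (rbits z) [] [] [] (kr KR.s1) = Γ'.bra :: (cbody c ++ [Γ'.ket] ++ rest) := by simp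
  have h1 := segRuns_e_lits S P F z hE Lo hLo hz c hc false false false [] s5 ([Γ'.ket] ++ rest)
  simp only [show uflag false = [] from rfl, Bool.false_or] at h1
  have h2 : Runs (entBody Γ'.ket) (Function.update (eSt S ([Γ'.ket] ++ rest) [] [] [] [] (uflag (hL z c)) (uflag (vtL P F z c)) (uflag (vfL P F z c)) (stL P F z c []) s5 (rbits z) [] [] [])
      (kr KR.s1) rest) (eSt S rest [] [] [] [] [] [] [] [] ((entWc P F z c).reverse ++ s5) (rbits z) [] [] []) ((6 * (stL P F z c []).length + 22) + 2) := by
    rw [update_eSt_s1]; unfold entBody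
    refine Runs.pop_nil (by simp) ?_
    refine (runs_clauseEndE S rest s5 (rbits z) (hL z c) (vtL P F z c) (vfL P F z c) (stL P F z c []) hE.t1).of_eq ?_ le_rfl
    unfold entWc
    rw [hL_eq]
    cases occursIn z c
    · simp
    · simp [wEntry, entryOf, patt_true_eq, patt_false_eq, stL_eq, List.reverse_append]
  have hk2 : eSt S ([Γ'.ket] ++ rest) [] [] [] [] (uflag (hL z c)) (uflag (vtL P F z c)) (uflag (vfL P F z c)) (stL P F z c []) s5 (rbits z) [] [] [] (kr KR.s1) = Γ'.ket :: rest := by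
    simp
  have := SegRuns.cons hk0 h0 ((h1.append (SegRuns.single hk2 h2)).cast rfl (by simp) rfl le_rfl)
  refine this.cast rfl rfl rfl ?_
  have hl := length_stL_le P F z Lo hLo c []
  have hcl : c.length ≤ (cbody c).length := by
    unfold cbody; rw [List.length_flatMap]
    calc c.length = (c.map fun _ => 1).sum := by simp
      _ ≤ _ := List.sum_le_sum (fun l _ => by simp [encodeLiteral_eq])
  simp only [List.length_append, List.length_cons, List.length_nil, cKe, Nat.zero_add] at hl ⊢
  have h3 : 6 * (stL P F z c []).length ≤ 6 * (Lo + 2) * (cbody c).length := by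
    calc 6 * (stL P F z c []).length ≤ 6 * ((Lo + 2) * c.length) := by omega
      _ ≤ 6 * ((Lo + 2) * (cbody c).length) := Nat.mul_le_mul_left _ (Nat.mul_le_mul_left _ hcl)
      _ = _ := by ring
  nlinarith [h3]

/-- **The clauses.** [folklore] -/
theorem segRuns_e_clauses : ∀ (G : List (List (ℕ × Bool))), (∀ c ∈ G, ∀ l ∈ c, l.1 ∈ occList F) → ∀ (s5 rest : List Γ'),
    SegRuns (kr KR.s1) entBody (wFam G) (eSt S (wFam G ++ rest) [] [] [] [] [] [] [] [] s5 (rbits z) [] [] [])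
      (eSt S rest [] [] [] [] [] [] [] [] ((G.flatMap (entWc P F z)).reverse ++ s5) (rbits z) [] [] [])
      (cKe Lo (wRecs (dictRecs P F (occList F))).length (bsz P) * (wFam G).length)
  | [], _, s5, rest => by simpa [wFam] using SegRuns.nil (kr KR.s1) entBody _
  | c :: G, hG, s5, rest => by
    have h1 := segRuns_e_clause S P F z hE Lo hLo hz c (hG c (by simp)) s5 (wFam G ++ rest)
    have h2 := segRuns_e_clauses G (fun c' h => hG c' (by simp [h])) ((entWc P F z c).reverse ++ s5) rest
    have := h1.append h2
    have hwc : wFam (c :: G) = KCNF.encodeClause c ++ wFam G := by rw [wFam_cons]; simp [KCNF.encodeClause, cbody]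
    refine this.cast hwc.symm (by rw [hwc, List.append_assoc]) (by simp [List.reverse_append]) ?_
    rw [hwc, List.length_append]; ring_nf; omega

omit hE hLo hz in
/-- The entries word of `z` over the clauses is that of `entries`. [folklore] -/
theorem flatMap_entWc (P : Params) (F : List (List (ℕ × Bool))) (z : ℕ) (G : List (List (ℕ × Bool))) :
    G.flatMap (entWc P F z) = ((G.filter (occursIn z)).map fun c => entryOf P F c z).flatMap wEntry := by
  induction G with
  | nil => rfl
  | cons c G ih =>
    rw [List.flatMap_cons, List.filter_cons, ih]
    unfold entWc
    cases occursIn z c <;> simp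

end ESpec2

/-- **Specification of `entPass`**: the words of the entries of `z` are appended (reversed) to
`s5`. [folklore] -/
theorem runs_entPass (S : RStore) (P : Params) (F : List (List (ℕ × Bool))) (z : ℕ) (hE : EBase S P F z) (Lo : ℕ)
    (hLo : (wRecs (ocRecs F P.cap (occList F))).length ≤ Lo) (hz : z ∈ occList F) (s5 : List Γ') :
    Runs entPass (eSt S [] [] [] [] [] [] [] [] [] s5 (rbits z) [] [] [])
      (eSt S [] [] [] [] [] [] [] [] [] (((entries P F z).flatMap wEntry).reverse ++ s5) (rbits z) [] [] [])
      ((cKe Lo (wRecs (dictRecs P F (occList F))).length (bsz P) + 10) * (wFam F).length + 4) := by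
  have hF : ∀ c ∈ F, ∀ l ∈ c, l.1 ∈ occList F := fun c hc l hl =>
    mem_occList.2 (mem_occVars.2 ⟨c, hc, occursIn_eq_true.2 ⟨l, hl, rfl⟩⟩)
  unfold entPass
  have h0 := runs_copyToG (a := kr KR.fam) (b := kr KR.s1) (t₁ := kr KR.t1) (t₂ := kr KR.t2)
    (by simp) (by simp) (by simp) (by simp) (by simp) (by simp) (eSt S [] [] [] [] [] [] [] [] [] s5 (rbits z) [] [] []) (by simp [hE.t1]) (by simp [hE.t2]) (by simp)
  rw [eSt_fam, hE.fam, update_eSt_s1] at h0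
  have h1 := (segRuns_e_clauses S P F z hE Lo hLo hz F hF s5 []).runs_loop_nil (by simp)
  simp only [List.append_nil] at h1
  rw [flatMap_entWc, ← entries] at h1
  exact (h0.seq h1).mono (by nlinarith)

/-! ### The block table of a mask: programs -/

/-- After incrementing the position counter: if it reached `m`, reset it and close the block in
the output. [folklore] -/
def popB : ℕ → RProg
  | 0 => clear (kr KR.s6) ;; clear (kr KR.posc) ;; push (kr KR.s5) Γ'.blank
  | n + 1 => pop (kr KR.s6) fun o => match o with
      | some _ => popB n
      | none => skip

/-- Wrap the position counter at `m`, closing the block. [folklore] -/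
def wrapB (m : ℕ) : RProg := copyToG (kr KR.posc) (kr KR.s6) (kr KR.t1) (kr KR.t2) ;; popB m

/-- One `B`-variable `z` (probe in `pr`): open a size digit if it starts a block, write its forcing
table and its `bra`, count it (position counter and size digit), wrap. [folklore] -/
def bvar (m : ℕ) : RProg :=
  (ifTop (kr KR.posc) fun o => match o with
    | some _ => skip
    | none => push (kr KR.szs) Γ'.comma) ;;
  copyToG (kr KR.pr) (kr KR.pr2) (kr KR.t1) (kr KR.t2) ;; entPass ;; push (kr KR.s5) Γ'.bra ;; push (kr KR.posc) Γ'.blank ;; push (kr KR.szs) Γ'.blank ;;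
  wrapB m ;; clear (kr KR.pr) ;; clear (kr KR.pr2)

/-- Body of the block-table builder over the copy `s3` of the dictionary (mode `md`: empty = key
bits to the probe, `comma` = the tag bit decides, `ket` = skip the rest of the payload). [folklore] -/
def btBody (m : ℕ) (s : Γ') : RProg :=
  pop (kr KR.md) fun o => match o, s with
    | none, Γ'.bit d => push (kr KR.pr) (Γ'.bit d)
    | none, Γ'.comma => push (kr KR.md) Γ'.comma
    | none, _ => skip
    | some Γ'.comma, Γ'.bit true => bvar m ;; push (kr KR.md) Γ'.ket
    | some Γ'.comma, _ => clear (kr KR.pr) ;; push (kr KR.md) Γ'.ket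
    | some Γ'.ket, Γ'.blank => skip
    | some Γ'.ket, _ => push (kr KR.md) Γ'.ket
    | some _, _ => skip

/-- **`btBuild m`**: the block table (`wBT (btab P F)`, built reversed on `s5` and poured into `bt`)
and the block-size digits (on `szs`, last block first). [folklore] -/
def btBuild (m : ℕ) : RProg :=
  copyToG (kr KR.dict) (kr KR.s3) (kr KR.t1) (kr KR.t2) ;; loop (kr KR.s3) (btBody m) ;;
  (ifTop (kr KR.posc) fun o => match o with
    | some _ => push (kr KR.s5) Γ'.blank
    | none => skip) ;;
  clear (kr KR.posc) ;; pour (kr KR.s5) (kr KR.bt)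

/-! ### Functional description -/

/-- The size digits after `n` `B`-variables (a stack: last block first; a digit is its blanks
closed by a comma). [folklore] -/
def szW (m : ℕ) : ℕ → List Γ'
  | 0 => []
  | n + 1 => (if n % m = 0 then [Γ'.blank, Γ'.comma] else [Γ'.blank]) ++ szW m n

/-- The output stack after the `B`-variables `bs`, starting with count `t` and stack `acc`.
[folklore] -/
def outS (P : Params) (F : List (List (ℕ × Bool))) : List ℕ → ℕ → List Γ' → List Γ'
  | [], _, acc => acc
  | z :: r, t, acc => outS P F r (t + 1) ((if (t + 1) % bsz P = 0 then [Γ'.blank] else []) ++ Γ'.bra :: ((entries P F z).flatMap wEntry).reverse ++ acc)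

/-- The store family `bSt` over a base store. [folklore] -/
def bSt (S : RStore) (s3 md pr s5 posc szs pr2 s6 : List Γ') : RStore := fun r =>
  if r = kr KR.s3 then s3 else if r = kr KR.md then md else if r = kr KR.pr then pr else if r = kr KR.s5 then s5 else if r = kr KR.posc then posc else if r = kr KR.szs then szs else if r = kr KR.pr2 then pr2 else if r = kr KR.s6 then s6 else S r

section BstLemmas

variable (S : RStore) (s3 md pr s5 posc szs pr2 s6 w : List Γ')

/-- Reading `s3`. [folklore] -/
@[simp] theorem bSt_s3 : bSt S s3 md pr s5 posc szs pr2 s6 (kr KR.s3) = s3 := by simp [bSt]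
/-- Reading `md`. [folklore] -/
@[simp] theorem bSt_md : bSt S s3 md pr s5 posc szs pr2 s6 (kr KR.md) = md := by simp [bSt]
/-- Reading `pr`. [folklore] -/
@[simp] theorem bSt_pr : bSt S s3 md pr s5 posc szs pr2 s6 (kr KR.pr) = pr := by simp [bSt]
/-- Reading `s5`. [folklore] -/
@[simp] theorem bSt_s5 : bSt S s3 md pr s5 posc szs pr2 s6 (kr KR.s5) = s5 := by simp [bSt]
/-- Reading `posc`. [folklore] -/
@[simp] theorem bSt_posc : bSt S s3 md pr s5 posc szs pr2 s6 (kr KR.posc) = posc := by simp [bSt]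
/-- Reading `szs`. [folklore] -/
@[simp] theorem bSt_szs : bSt S s3 md pr s5 posc szs pr2 s6 (kr KR.szs) = szs := by simp [bSt]
/-- Reading `pr2`. [folklore] -/
@[simp] theorem bSt_pr2 : bSt S s3 md pr s5 posc szs pr2 s6 (kr KR.pr2) = pr2 := by simp [bSt]
/-- Reading `s6`. [folklore] -/
@[simp] theorem bSt_s6 : bSt S s3 md pr s5 posc szs pr2 s6 (kr KR.s6) = s6 := by simp [bSt]
/-- Reading any other register. [folklore] -/
theorem bSt_other {r : Reg} (h0 : r ≠ kr KR.s3) (h1 : r ≠ kr KR.md) (h2 : r ≠ kr KR.pr) (h3 : r ≠ kr KR.s5) (h4 : r ≠ kr KR.posc) (h5 : r ≠ kr KR.szs) (h6 : r ≠ kr KR.pr2) (h7 : r ≠ kr KR.s6) :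
    bSt S s3 md pr s5 posc szs pr2 s6 r = S r := by simp [bSt, h0, h1, h2, h3, h4, h5, h6, h7]
/-- Reading `dict`. [folklore] -/
@[simp] theorem bSt_dict : bSt S s3 md pr s5 posc szs pr2 s6 (kr KR.dict) = S (kr KR.dict) := by simp [bSt]
/-- Reading `fam`. [folklore] -/
@[simp] theorem bSt_fam : bSt S s3 md pr s5 posc szs pr2 s6 (kr KR.fam) = S (kr KR.fam) := by simp [bSt]
/-- Reading `t1`. [folklore] -/
@[simp] theorem bSt_t1 : bSt S s3 md pr s5 posc szs pr2 s6 (kr KR.t1) = S (kr KR.t1) := by simp [bSt]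
/-- Reading `t2`. [folklore] -/
@[simp] theorem bSt_t2 : bSt S s3 md pr s5 posc szs pr2 s6 (kr KR.t2) = S (kr KR.t2) := by simp [bSt]
/-- Reading `bt`. [folklore] -/
@[simp] theorem bSt_bt : bSt S s3 md pr s5 posc szs pr2 s6 (kr KR.bt) = S (kr KR.bt) := by simp [bSt]
/-- Updating `s3`. [folklore] -/
@[simp] theorem update_bSt_s3 : Function.update (bSt S s3 md pr s5 posc szs pr2 s6) (kr KR.s3) w = bSt S w md pr s5 posc szs pr2 s6 := by
  funext r; by_cases h : r = kr KR.s3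
  · subst h; simp
  · rw [Function.update_of_ne h]; simp [bSt, h]
/-- Updating `md`. [folklore] -/
@[simp] theorem update_bSt_md : Function.update (bSt S s3 md pr s5 posc szs pr2 s6) (kr KR.md) w = bSt S s3 w pr s5 posc szs pr2 s6 := by
  funext r; by_cases h : r = kr KR.md
  · subst h; simp
  · rw [Function.update_of_ne h]; simp [bSt, h]
/-- Updating `pr`. [folklore] -/
@[simp] theorem update_bSt_pr : Function.update (bSt S s3 md pr s5 posc szs pr2 s6) (kr KR.pr) w = bSt S s3 md w s5 posc szs pr2 s6 := by
  funext r; by_cases h : r = kr KR.pr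
  · subst h; simp
  · rw [Function.update_of_ne h]; simp [bSt, h]
/-- Updating `s5`. [folklore] -/
@[simp] theorem update_bSt_s5 : Function.update (bSt S s3 md pr s5 posc szs pr2 s6) (kr KR.s5) w = bSt S s3 md pr w posc szs pr2 s6 := by
  funext r; by_cases h : r = kr KR.s5
  · subst h; simp
  · rw [Function.update_of_ne h]; simp [bSt, h]
/-- Updating `posc`. [folklore] -/
@[simp] theorem update_bSt_posc : Function.update (bSt S s3 md pr s5 posc szs pr2 s6) (kr KR.posc) w = bSt S s3 md pr s5 w szs pr2 s6 := by
  funext r; by_cases h : r = kr KR.posc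
  · subst h; simp
  · rw [Function.update_of_ne h]; simp [bSt, h]
/-- Updating `szs`. [folklore] -/
@[simp] theorem update_bSt_szs : Function.update (bSt S s3 md pr s5 posc szs pr2 s6) (kr KR.szs) w = bSt S s3 md pr s5 posc w pr2 s6 := by
  funext r; by_cases h : r = kr KR.szs
  · subst h; simp
  · rw [Function.update_of_ne h]; simp [bSt, h]
/-- Updating `pr2`. [folklore] -/
@[simp] theorem update_bSt_pr2 : Function.update (bSt S s3 md pr s5 posc szs pr2 s6) (kr KR.pr2) w = bSt S s3 md pr s5 posc szs w s6 := by
  funext r; by_cases h : r = kr KR.pr2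
  · subst h; simp
  · rw [Function.update_of_ne h]; simp [bSt, h]
/-- Updating `s6`. [folklore] -/
@[simp] theorem update_bSt_s6 : Function.update (bSt S s3 md pr s5 posc szs pr2 s6) (kr KR.s6) w = bSt S s3 md pr s5 posc szs pr2 w := by
  funext r; by_cases h : r = kr KR.s6
  · subst h; simp
  · rw [Function.update_of_ne h]; simp [bSt, h]

end BstLemmas

/-- Every store is a `bSt` over itself. [folklore] -/
theorem bSt_eta (R : RStore) : bSt R (R (kr KR.s3)) (R (kr KR.md)) (R (kr KR.pr)) (R (kr KR.s5)) (R (kr KR.posc)) (R (kr KR.szs)) (R (kr KR.pr2)) (R (kr KR.s6)) = R := by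
  funext r
  by_cases h0 : r = kr KR.s3; · subst h0; simp
  by_cases h1 : r = kr KR.md; · subst h1; simp
  by_cases h2 : r = kr KR.pr; · subst h2; simp
  by_cases h3 : r = kr KR.s5; · subst h3; simp
  by_cases h4 : r = kr KR.posc; · subst h4; simp
  by_cases h5 : r = kr KR.szs; · subst h5; simp
  by_cases h6 : r = kr KR.pr2; · subst h6; simp
  by_cases h7 : r = kr KR.s6; · subst h7; simp
  rw [bSt_other _ _ _ _ _ _ _ _ _ h0 h1 h2 h3 h4 h5 h6 h7]

/-- What the block-table builder needs of the base store. [folklore] -/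
structure BtBase (S : RStore) (P : Params) (F : List (List (ℕ × Bool))) : Prop where
  /-- the dictionary -/
  dict : S (kr KR.dict) = wRecs (dictRecs P F (occList F))
  /-- the clauses -/
  fam : S (kr KR.fam) = wFam F
  /-- scratch -/
  t1 : S (kr KR.t1) = []
  /-- scratch -/
  t2 : S (kr KR.t2) = []
  /-- scratch -/
  x2 : S (kr KR.x2) = []
  /-- scratch -/
  vw : S (kr KR.vw) = []
  /-- scratch -/
  eb : S (kr KR.eb) = []
  /-- scratch -/
  lmd : S (kr KR.lmd) = []
  /-- scratch -/
  dict2 : S (kr KR.dict2) = []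
  /-- scratch -/
  s1 : S (kr KR.s1) = []
  /-- scratch -/
  ex : S (kr KR.ex) = []
  /-- scratch -/
  ju : S (kr KR.ju) = []
  /-- scratch -/
  lpol : S (kr KR.lpol) = []
  /-- scratch -/
  fl : S (kr KR.fl) = []
  /-- scratch -/
  ft : S (kr KR.ft) = []
  /-- scratch -/
  ff : S (kr KR.ff) = []
  /-- scratch -/
  s2 : S (kr KR.s2) = []
  /-- scratch -/
  ne : S (kr KR.ne) = []
  /-- scratch -/
  fnd : S (kr KR.fnd) = []
  /-- scratch -/
  key : S (kr KR.key) = []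

/-! ### The block table of a mask: specifications -/

section BtSpec

variable (S : RStore) (P : Params) (F : List (List (ℕ × Bool))) (hB : BtBase S P F) (Lo : ℕ) (hLo : (wRecs (ocRecs F P.cap (occList F))).length ≤ Lo)
include hB hLo

omit hB hLo in
/-- **`popB`.** [folklore] -/
theorem runs_popB (s3 md pr szs pr2 : List Γ') : ∀ (n j : ℕ) (s5 posc : List Γ'),
    Runs (popB n) (bSt S s3 md pr s5 posc szs pr2 (List.replicate j Γ'.blank))
      (if n ≤ j then bSt S s3 md pr (Γ'.blank :: s5) [] szs pr2 [] else bSt S s3 md pr s5 posc szs pr2 []) (2 * n + 2 * j + 2 * posc.length + 6)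
  | 0, j, s5, posc => by
    unfold popB
    rw [if_pos (Nat.zero_le _)]
    have h1 := runs_clear (kr KR.s6) (bSt S s3 md pr s5 posc szs pr2 (List.replicate j Γ'.blank))
    rw [bSt_s6, update_bSt_s6, List.length_replicate] at h1
    have h2 := runs_clear (kr KR.posc) (bSt S s3 md pr s5 posc szs pr2 [])
    rw [bSt_posc, update_bSt_posc] at h2
    have h3 : Runs (push (kr KR.s5) Γ'.blank) (bSt S s3 md pr s5 [] szs pr2 []) (bSt S s3 md pr (Γ'.blank :: s5) [] szs pr2 []) 1 := Runs.push' (by simp)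
    exact (h1.seq (h2.seq h3)).mono (by omega)
  | n + 1, 0, s5, posc => by
    unfold popB
    rw [if_neg (by omega), List.replicate_zero]
    have hin : Runs skip (bSt S s3 md pr s5 posc szs pr2 []) (bSt S s3 md pr s5 posc szs pr2 []) 0 := Runs.skip _
    exact (Runs.pop_nil (by simp) hin).mono (by omega)
  | n + 1, j + 1, s5, posc => by
    unfold popB
    rw [List.replicate_succ]
    have ih := runs_popB s3 md pr szs pr2 n j s5 posc
    have hin : Runs (popB n) (Function.update (bSt S s3 md pr s5 posc szs pr2 (Γ'.blank :: List.replicate j Γ'.blank)) (kr KR.s6) (List.replicate j Γ'.blank))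
        (if n + 1 ≤ j + 1 then bSt S s3 md pr (Γ'.blank :: s5) [] szs pr2 [] else bSt S s3 md pr s5 posc szs pr2 []) (2 * n + 2 * j + 2 * posc.length + 6) := by
      rw [update_bSt_s6]
      by_cases h : n ≤ j
      · rw [if_pos h] at ih; rw [if_pos (by omega)]; exact ih
      · rw [if_neg h] at ih; rw [if_neg (by omega)]; exact ih
    exact (Runs.pop_cons (k := kr KR.s6) (a := Γ'.blank) (w := List.replicate j Γ'.blank) (by simp) hin).mono (by omega)

omit hLo in
/-- **`wrapB m`** after the increment (`j + 1 ≤ m` blanks). [folklore] -/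
theorem runs_wrapB (s3 md pr s5 szs pr2 : List Γ') (j : ℕ) (hj : j < bsz P) :
    Runs (wrapB (bsz P)) (bSt S s3 md pr s5 (List.replicate (j + 1) Γ'.blank) szs pr2 [])
      (bSt S s3 md pr ((if (j + 1) % bsz P = 0 then [Γ'.blank] else []) ++ s5) (List.replicate ((j + 1) % bsz P) Γ'.blank) szs pr2 [])
      ((10 * (j + 1) + 3) + (4 * bsz P + 2 * (j + 1) + 8)) := by
  set m := bsz P with hm
  unfold wrapB
  have h1 := runs_copyToG (a := kr KR.posc) (b := kr KR.s6) (t₁ := kr KR.t1) (t₂ := kr KR.t2)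
    (by simp) (by simp) (by simp) (by simp) (by simp) (by simp) (bSt S s3 md pr s5 (List.replicate (j + 1) Γ'.blank) szs pr2 [])
    (by simp [hB.t1]) (by simp [hB.t2]) (by simp)
  rw [bSt_posc, update_bSt_s6, List.length_replicate] at h1
  have h2 := runs_popB S s3 md pr szs pr2 m (j + 1) s5 (List.replicate (j + 1) Γ'.blank)
  rw [List.length_replicate] at h2
  by_cases h : m ≤ j + 1
  · have hjm : j + 1 = m := by omega
    rw [if_pos h] at h2
    refine (h1.seq h2).of_eq ?_ (by omega)
    rw [hjm, Nat.mod_self]; simp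
  · rw [if_neg h] at h2
    refine (h1.seq h2).of_eq ?_ (by omega)
    rw [Nat.mod_eq_of_lt (by omega), if_neg (by omega)]; simp

/-- The cost of one `B`-variable. [folklore] -/
def bvarCost (Lo Ld m Wf : ℕ) : ℕ := 4 + (10 * Lo + 3) + ((cKe Lo Ld m + 10) * Wf + 4) + 3 + ((10 * m + 3) + (4 * m + 2 * m + 8)) + (2 * Lo + 1) + (2 * Lo + 1)

/-- **One `B`-variable.** [folklore] -/
theorem runs_bvar (z : ℕ) (hz : z ∈ occList F) (s3 s5 : List Γ') (n : ℕ) :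
    Runs (bvar (bsz P)) (bSt S s3 [] (rbits z) s5 (List.replicate (n % bsz P) Γ'.blank) (szW (bsz P) n) [] [])
      (bSt S s3 [] [] ((if (n + 1) % bsz P = 0 then [Γ'.blank] else []) ++ Γ'.bra :: ((entries P F z).flatMap wEntry).reverse ++ s5)
        (List.replicate ((n + 1) % bsz P) Γ'.blank) (szW (bsz P) (n + 1)) [] [])
      (bvarCost Lo (wRecs (dictRecs P F (occList F))).length (bsz P) (wFam F).length) := by
  set m := bsz P with hm
  have hm0 : 0 < m := bsz_pos P
  have hzL := rbits_le_of_mem P F Lo hLo hz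
  set j := n % m with hj
  have hjm : j < m := Nat.mod_lt _ hm0
  unfold bvar
  -- 1. the size digit
  have h1 : Runs (ifTop (kr KR.posc) fun o => match o with
      | some _ => skip
      | none => push (kr KR.szs) Γ'.comma) (bSt S s3 [] (rbits z) s5 (List.replicate j Γ'.blank) (szW m n) [] [])
      (bSt S s3 [] (rbits z) s5 (List.replicate j Γ'.blank) ((if j = 0 then [Γ'.comma] else []) ++ szW m n) [] []) 4 := by
    cases hj0 : j with
    | zero =>
      rw [if_pos rfl, List.replicate_zero]
      exact (Runs.ifTop_nil (R := bSt S s3 [] (rbits z) s5 [] (szW m n) [] []) (by simp) (Runs.push' (by simp))).mono (by norm_num)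
    | succ j' =>
      rw [if_neg (Nat.succ_ne_zero _), List.nil_append, List.replicate_succ]
      exact (Runs.ifTop_cons (R := bSt S s3 [] (rbits z) s5 (Γ'.blank :: List.replicate j' Γ'.blank) (szW m n) [] []) (x := Γ'.blank) (w := List.replicate j' Γ'.blank)
        (by simp) (Runs.skip _)).mono (by norm_num)
  set sz1 := (if j = 0 then [Γ'.comma] else []) ++ szW m n with hsz1
  -- 2. save the probe
  have h2 := runs_copyToG (a := kr KR.pr) (b := kr KR.pr2) (t₁ := kr KR.t1) (t₂ := kr KR.t2)
    (by simp) (by simp) (by simp) (by simp) (by simp) (by simp) (bSt S s3 [] (rbits z) s5 (List.replicate j Γ'.blank) sz1 [] []) (by simp [hB.t1]) (by simp [hB.t2]) (by simp)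
  rw [bSt_pr, update_bSt_pr2] at h2
  -- 3. the pass
  set X := bSt S s3 [] (rbits z) s5 (List.replicate j Γ'.blank) sz1 (rbits z) [] with hX
  have hEX : EBase X P F z :=
    { pr2 := by simp [hX], dict := by rw [hX, bSt_dict]; exact hB.dict, fam := by rw [hX, bSt_fam]; exact hB.fam, t1 := by rw [hX, bSt_t1]; exact hB.t1,
      t2 := by rw [hX, bSt_t2]; exact hB.t2, x2 := by rw [hX, bSt_other] <;> simp [hB.x2], vw := by rw [hX, bSt_other] <;> simp [hB.vw],
      eb := by rw [hX, bSt_other] <;> simp [hB.eb], lmd := by rw [hX, bSt_other] <;> simp [hB.lmd], dict2 := by rw [hX, bSt_other] <;> simp [hB.dict2] }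
  have eX : eSt X [] [] [] [] [] [] [] [] [] s5 (rbits z) [] [] [] = X := by
    have e := eSt_eta X
    have r1 : X (kr KR.s1) = [] := by rw [hX, bSt_other] <;> simp [hB.s1]
    have r2 : X (kr KR.md) = [] := by simp [hX]
    have r3 : X (kr KR.ex) = [] := by rw [hX, bSt_other] <;> simp [hB.ex]
    have r4 : X (kr KR.ju) = [] := by rw [hX, bSt_other] <;> simp [hB.ju]
    have r5 : X (kr KR.lpol) = [] := by rw [hX, bSt_other] <;> simp [hB.lpol]
    have r6 : X (kr KR.fl) = [] := by rw [hX, bSt_other] <;> simp [hB.fl]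
    have r7 : X (kr KR.ft) = [] := by rw [hX, bSt_other] <;> simp [hB.ft]
    have r8 : X (kr KR.ff) = [] := by rw [hX, bSt_other] <;> simp [hB.ff]
    have r9 : X (kr KR.s2) = [] := by rw [hX, bSt_other] <;> simp [hB.s2]
    have r10 : X (kr KR.s5) = s5 := by simp [hX]
    have r11 : X (kr KR.pr) = rbits z := by simp [hX]
    have r12 : X (kr KR.ne) = [] := by rw [hX, bSt_other] <;> simp [hB.ne]
    have r13 : X (kr KR.fnd) = [] := by rw [hX, bSt_other] <;> simp [hB.fnd]
    have r14 : X (kr KR.key) = [] := by rw [hX, bSt_other] <;> simp [hB.key]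
    rw [r1, r2, r3, r4, r5, r6, r7, r8, r9, r10, r11, r12, r13, r14] at e
    exact e
  have h3 := runs_entPass X P F z hEX Lo hLo hz s5
  rw [eX] at h3
  have e3 : eSt X [] [] [] [] [] [] [] [] [] (((entries P F z).flatMap wEntry).reverse ++ s5) (rbits z) [] [] [] =
      bSt S s3 [] (rbits z) (((entries P F z).flatMap wEntry).reverse ++ s5) (List.replicate j Γ'.blank) sz1 (rbits z) [] := by
    rw [← update_eSt_s5 X [] [] [] [] [] [] [] [] [] s5 (rbits z) [] [] [], eX, hX, update_bSt_s5]
  rw [e3] at h3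
  set out := ((entries P F z).flatMap wEntry).reverse ++ s5 with hout
  -- 4. bra, counters
  have h4 : Runs (push (kr KR.s5) Γ'.bra) (bSt S s3 [] (rbits z) out (List.replicate j Γ'.blank) sz1 (rbits z) [])
      (bSt S s3 [] (rbits z) (Γ'.bra :: out) (List.replicate j Γ'.blank) sz1 (rbits z) []) 1 := Runs.push' (by simp)
  have h5 : Runs (push (kr KR.posc) Γ'.blank) (bSt S s3 [] (rbits z) (Γ'.bra :: out) (List.replicate j Γ'.blank) sz1 (rbits z) [])
      (bSt S s3 [] (rbits z) (Γ'.bra :: out) (List.replicate (j + 1) Γ'.blank) sz1 (rbits z) []) 1 := Runs.push' (by rw [bSt_posc, update_bSt_posc, List.replicate_succ])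
  have h6 : Runs (push (kr KR.szs) Γ'.blank) (bSt S s3 [] (rbits z) (Γ'.bra :: out) (List.replicate (j + 1) Γ'.blank) sz1 (rbits z) [])
      (bSt S s3 [] (rbits z) (Γ'.bra :: out) (List.replicate (j + 1) Γ'.blank) (Γ'.blank :: sz1) (rbits z) []) 1 := Runs.push' (by simp)
  -- 5. wrap
  have h7 := runs_wrapB S P F hB s3 [] (rbits z) (Γ'.bra :: out) (Γ'.blank :: sz1) (rbits z) j hjm
  -- 6. cleanup
  have h8 := runs_clear (kr KR.pr) (bSt S s3 [] (rbits z) ((if (j + 1) % m = 0 then [Γ'.blank] else []) ++ Γ'.bra :: out) (List.replicate ((j + 1) % m) Γ'.blank) (Γ'.blank :: sz1) (rbits z) [])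
  rw [bSt_pr, update_bSt_pr] at h8
  have h9 := runs_clear (kr KR.pr2) (bSt S s3 [] [] ((if (j + 1) % m = 0 then [Γ'.blank] else []) ++ Γ'.bra :: out) (List.replicate ((j + 1) % m) Γ'.blank) (Γ'.blank :: sz1) (rbits z) [])
  rw [bSt_pr2, update_bSt_pr2] at h9
  refine (h1.seq (h2.seq (h3.seq (h4.seq (h5.seq (h6.seq (h7.seq (h8.seq h9)))))))).of_eq ?_ ?_
  · have hjn : (j + 1) % m = (n + 1) % m := by rw [hj, Nat.mod_add_mod]
    have hsz : Γ'.blank :: sz1 = szW m (n + 1) := by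
      rw [hsz1, szW, hj]
      by_cases h0 : n % m = 0
      · rw [if_pos h0, if_pos h0]; rfl
      · rw [if_neg h0, if_neg h0]; rfl
    rw [hjn, hsz, hout]; simp
  · simp only [← hm]
    unfold bvarCost; omega

/-- The per-record budget of the block-table builder. [folklore] -/
def bK (Lo Ld m Wf : ℕ) : ℕ := bvarCost Lo Ld m Wf + 2 * Lo + 20

omit hB hLo in
/-- Key bits go to the probe (mode empty). [folklore] -/
theorem segRuns_bt_bits (s5 posc szs : List Γ') : ∀ (u : List Bool) (rest pr : List Γ'),
    SegRuns (kr KR.s3) (btBody (bsz P)) (u.map Γ'.bit) (bSt S (u.map Γ'.bit ++ rest) [] pr s5 posc szs [] [])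
      (bSt S rest [] ((u.map Γ'.bit).reverse ++ pr) s5 posc szs [] []) (5 * u.length)
  | [], rest, pr => by simpa using SegRuns.nil (kr KR.s3) (btBody (bsz P)) _
  | d :: u, rest, pr => by
    have hbody : Runs (btBody (bsz P) (Γ'.bit d)) (Function.update (bSt S (Γ'.bit d :: (u.map Γ'.bit ++ rest)) [] pr s5 posc szs [] []) (kr KR.s3) (u.map Γ'.bit ++ rest))
        (bSt S (u.map Γ'.bit ++ rest) [] (Γ'.bit d :: pr) s5 posc szs [] []) (1 + 2) := by
      rw [update_bSt_s3]; unfold btBody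
      exact Runs.pop_nil (by simp) (Runs.push' (by simp))
    have ih := segRuns_bt_bits s5 posc szs u rest (Γ'.bit d :: pr)
    have hk : bSt S (Γ'.bit d :: (u.map Γ'.bit ++ rest)) [] pr s5 posc szs [] [] (kr KR.s3) = Γ'.bit d :: (u.map Γ'.bit ++ rest) := by simp
    refine (SegRuns.cons hk hbody ih).cast (by simp) (by simp) (by simp) ?_
    simp only [List.length_cons]; omega

omit hB hLo in
/-- Payload symbols after the tag are skipped (mode `ket`). [folklore] -/
theorem segRuns_bt_skip (pr s5 posc szs : List Γ') : ∀ (u : List Γ'), Γ'.blank ∉ u → ∀ (rest : List Γ'),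
    SegRuns (kr KR.s3) (btBody (bsz P)) u (bSt S (u ++ rest) [Γ'.ket] pr s5 posc szs [] []) (bSt S rest [Γ'.ket] pr s5 posc szs [] []) (5 * u.length)
  | [], _, rest => by simpa using SegRuns.nil (kr KR.s3) (btBody (bsz P)) _
  | s :: u, hu, rest => by
    have hs : s ≠ Γ'.blank := fun h => hu (by simp [h])
    have hu' : Γ'.blank ∉ u := fun h => hu (by simp [h])
    have hbody : Runs (btBody (bsz P) s) (Function.update (bSt S (s :: u ++ rest) [Γ'.ket] pr s5 posc szs [] []) (kr KR.s3) (u ++ rest))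
        (bSt S (u ++ rest) [Γ'.ket] pr s5 posc szs [] []) (1 + 2) := by
      rw [update_bSt_s3]; unfold btBody
      refine Runs.pop_cons (k := kr KR.md) (a := Γ'.ket) (w := []) (by simp) ?_
      rw [update_bSt_md]
      cases s with
      | blank => exact absurd rfl hs
      | bit b => exact Runs.push' (by simp)
      | bra => exact Runs.push' (by simp)
      | ket => exact Runs.push' (by simp)
      | comma => exact Runs.push' (by simp)
    have ih := segRuns_bt_skip pr s5 posc szs u hu' rest
    have hk : bSt S (s :: u ++ rest) [Γ'.ket] pr s5 posc szs [] [] (kr KR.s3) = s :: (u ++ rest) := by simp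
    refine (SegRuns.cons hk hbody ih).cast rfl rfl rfl ?_
    simp only [List.length_cons]; omega

/-- **One dictionary record** of the variable `x` after `n` `B`-variables. [folklore] -/
theorem segRuns_bt_record (x : ℕ) (hx : x ∈ occList F) (n : ℕ) (s5 more : List Γ') :
    SegRuns (kr KR.s3) (btBody (bsz P)) (bitsN x ++ Γ'.comma :: (dpay P F x ++ [Γ'.blank]))
      (bSt S (bitsN x ++ Γ'.comma :: (dpay P F x ++ [Γ'.blank]) ++ more) [] [] s5 (List.replicate (n % bsz P) Γ'.blank) (szW (bsz P) n) [] [])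
      (bSt S more [] [] (outS P F (if inB P F x then [x] else []) n s5)
        (List.replicate ((n + if inB P F x then 1 else 0) % bsz P) Γ'.blank) (szW (bsz P) (n + if inB P F x then 1 else 0)) [] [])
      (bK Lo (wRecs (dictRecs P F (occList F))).length (bsz P) (wFam F).length + 5 * (bitsN x ++ Γ'.comma :: (dpay P F x ++ [Γ'.blank])).length) := by
  have hxL := rbits_le_of_mem P F Lo hLo hx
  -- 1. key bits
  have h1 := segRuns_bt_bits S P s5 (List.replicate (n % (bsz P)) Γ'.blank) (szW (bsz P) n) (encodeNat x) (Γ'.comma :: (dpay P F x ++ [Γ'.blank]) ++ more) []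
  rw [List.append_nil] at h1
  have hrb : ((encodeNat x).map Γ'.bit).reverse = rbits x := rfl
  rw [hrb] at h1
  -- 2. comma
  have h2 : Runs (btBody (bsz P) Γ'.comma) (Function.update (bSt S (Γ'.comma :: (dpay P F x ++ [Γ'.blank]) ++ more) [] (rbits x) s5 (List.replicate (n % (bsz P)) Γ'.blank) (szW (bsz P) n) [] [])
      (kr KR.s3) (dpay P F x ++ [Γ'.blank] ++ more)) (bSt S (dpay P F x ++ [Γ'.blank] ++ more) [Γ'.comma] (rbits x) s5 (List.replicate (n % (bsz P)) Γ'.blank) (szW (bsz P) n) [] []) (1 + 2) := by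
    rw [update_bSt_s3]; unfold btBody
    exact Runs.pop_nil (by simp) (Runs.push' (by simp))
  have hk2 : bSt S (Γ'.comma :: (dpay P F x ++ [Γ'.blank]) ++ more) [] (rbits x) s5 (List.replicate (n % (bsz P)) Γ'.blank) (szW (bsz P) n) [] [] (kr KR.s3) =
      Γ'.comma :: (dpay P F x ++ [Γ'.blank] ++ more) := by simp
  -- 3. the tag and the rest
  cases hBx : inB P F x with
  | true =>
    simp only [if_true]
    set pay := List.replicate (blockOf P F x) Γ'.ket ++ List.replicate (posIn P F x) Γ'.bra ++ [Γ'.comma] with hpay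
    have hdp : dpay P F x = Γ'.bit true :: pay := by unfold dpay; rw [if_pos hBx]
    rw [hdp] at h1 h2 hk2 ⊢
    have hpb : Γ'.blank ∉ pay := by simp [hpay]
    have h3 : Runs (btBody (bsz P) (Γ'.bit true)) (Function.update (bSt S (Γ'.bit true :: pay ++ [Γ'.blank] ++ more) [Γ'.comma] (rbits x) s5 (List.replicate (n % (bsz P)) Γ'.blank) (szW (bsz P) n) [] [])
        (kr KR.s3) (pay ++ [Γ'.blank] ++ more))
        (bSt S (pay ++ [Γ'.blank] ++ more) [Γ'.ket] [] ((if (n + 1) % (bsz P) = 0 then [Γ'.blank] else []) ++ Γ'.bra :: ((entries P F x).flatMap wEntry).reverse ++ s5)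
          (List.replicate ((n + 1) % (bsz P)) Γ'.blank) (szW (bsz P) (n + 1)) [] []) ((bvarCost Lo (wRecs (dictRecs P F (occList F))).length (bsz P) (wFam F).length + 1) + 2) := by
      rw [update_bSt_s3]; unfold btBody
      refine Runs.pop_cons (k := kr KR.md) (a := Γ'.comma) (w := []) (by simp) ?_
      rw [update_bSt_md]
      exact (runs_bvar S P F hB Lo hLo x hx (pay ++ [Γ'.blank] ++ more) s5 n).seq (Runs.push' (by simp))
    have hk3 : bSt S (Γ'.bit true :: pay ++ [Γ'.blank] ++ more) [Γ'.comma] (rbits x) s5 (List.replicate (n % (bsz P)) Γ'.blank) (szW (bsz P) n) [] [] (kr KR.s3) =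
        Γ'.bit true :: (pay ++ [Γ'.blank] ++ more) := by simp
    set out := (if (n + 1) % (bsz P) = 0 then [Γ'.blank] else []) ++ Γ'.bra :: ((entries P F x).flatMap wEntry).reverse ++ s5 with hout
    have h4 := segRuns_bt_skip S P [] out (List.replicate ((n + 1) % (bsz P)) Γ'.blank) (szW (bsz P) (n + 1)) pay hpb ([Γ'.blank] ++ more)
    have h5 : Runs (btBody (bsz P) Γ'.blank) (Function.update (bSt S ([Γ'.blank] ++ more) [Γ'.ket] [] out (List.replicate ((n + 1) % (bsz P)) Γ'.blank) (szW (bsz P) (n + 1)) [] []) (kr KR.s3) more)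
        (bSt S more [] [] out (List.replicate ((n + 1) % (bsz P)) Γ'.blank) (szW (bsz P) (n + 1)) [] []) (0 + 2) := by
      rw [update_bSt_s3]; unfold btBody
      exact Runs.pop_cons (k := kr KR.md) (a := Γ'.ket) (w := []) (by simp) ((Runs.skip _).of_eq (by simp) le_rfl)
    have hk5 : bSt S ([Γ'.blank] ++ more) [Γ'.ket] [] out (List.replicate ((n + 1) % (bsz P)) Γ'.blank) (szW (bsz P) (n + 1)) [] [] (kr KR.s3) = Γ'.blank :: more := by simp
    have h345 := SegRuns.cons hk3 h3 ((h4.append (SegRuns.single hk5 h5)).cast rfl (by simp) rfl le_rfl)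
    have := h1.append (SegRuns.cons hk2 h2 (h345.cast rfl (by simp) rfl le_rfl))
    refine this.cast (by simp [hpay]) (by simp [hpay]) (by simp [outS, hout]) ?_
    simp only [List.length_append, List.length_cons, List.length_map, List.length_nil, hpay, List.length_replicate, bK]
    omega
  | false =>
    simp only [Bool.false_eq_true, if_false, Nat.add_zero]
    set pay := (encodeNat (newIdxA P F x)).map Γ'.bit ++ [Γ'.comma] with hpay
    have hdp : dpay P F x = Γ'.bit false :: pay := by unfold dpay; rw [if_neg (by simp [hBx])]
    rw [hdp] at h1 h2 hk2 ⊢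
    have hpb : Γ'.blank ∉ pay := by simp [hpay]
    have h3 : Runs (btBody (bsz P) (Γ'.bit false)) (Function.update (bSt S (Γ'.bit false :: pay ++ [Γ'.blank] ++ more) [Γ'.comma] (rbits x) s5 (List.replicate (n % (bsz P)) Γ'.blank) (szW (bsz P) n) [] [])
        (kr KR.s3) (pay ++ [Γ'.blank] ++ more))
        (bSt S (pay ++ [Γ'.blank] ++ more) [Γ'.ket] [] s5 (List.replicate (n % (bsz P)) Γ'.blank) (szW (bsz P) n) [] []) (((2 * (rbits x).length + 1) + 1) + 2) := by
      rw [update_bSt_s3]; unfold btBody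
      refine Runs.pop_cons (k := kr KR.md) (a := Γ'.comma) (w := []) (by simp) ?_
      rw [update_bSt_md]
      have hc := runs_clear (kr KR.pr) (bSt S (pay ++ [Γ'.blank] ++ more) [] (rbits x) s5 (List.replicate (n % (bsz P)) Γ'.blank) (szW (bsz P) n) [] [])
      rw [bSt_pr, update_bSt_pr] at hc
      exact hc.seq (Runs.push' (by simp))
    have hk3 : bSt S (Γ'.bit false :: pay ++ [Γ'.blank] ++ more) [Γ'.comma] (rbits x) s5 (List.replicate (n % (bsz P)) Γ'.blank) (szW (bsz P) n) [] [] (kr KR.s3) =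
        Γ'.bit false :: (pay ++ [Γ'.blank] ++ more) := by simp
    have h4 := segRuns_bt_skip S P [] s5 (List.replicate (n % (bsz P)) Γ'.blank) (szW (bsz P) n) pay hpb ([Γ'.blank] ++ more)
    have h5 : Runs (btBody (bsz P) Γ'.blank) (Function.update (bSt S ([Γ'.blank] ++ more) [Γ'.ket] [] s5 (List.replicate (n % (bsz P)) Γ'.blank) (szW (bsz P) n) [] []) (kr KR.s3) more)
        (bSt S more [] [] s5 (List.replicate (n % (bsz P)) Γ'.blank) (szW (bsz P) n) [] []) (0 + 2) := by
      rw [update_bSt_s3]; unfold btBody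
      exact Runs.pop_cons (k := kr KR.md) (a := Γ'.ket) (w := []) (by simp) ((Runs.skip _).of_eq (by simp) le_rfl)
    have hk5 : bSt S ([Γ'.blank] ++ more) [Γ'.ket] [] s5 (List.replicate (n % (bsz P)) Γ'.blank) (szW (bsz P) n) [] [] (kr KR.s3) = Γ'.blank :: more := by simp
    have h345 := SegRuns.cons hk3 h3 ((h4.append (SegRuns.single hk5 h5)).cast rfl (by simp) rfl le_rfl)
    have := h1.append (SegRuns.cons hk2 h2 (h345.cast rfl (by simp) rfl le_rfl))
    refine this.cast (by simp [hpay]) (by simp [hpay]) (by simp [outS]) ?_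
    simp only [List.length_append, List.length_cons, List.length_map, List.length_nil, hpay, bK]
    omega

end BtSpec

/-! ### The block table of a mask: all records -/

/-- `outS` over an append. [folklore] -/
theorem outS_append (P : Params) (F : List (List (ℕ × Bool))) : ∀ (l₁ l₂ : List ℕ) (t : ℕ) (acc : List Γ'),
    outS P F (l₁ ++ l₂) t acc = outS P F l₂ (t + l₁.length) (outS P F l₁ t acc)
  | [], l₂, t, acc => by simp [outS]
  | z :: l₁, l₂, t, acc => by
    rw [List.cons_append, outS, outS, outS_append P F l₁ l₂]
    simp only [List.length_cons]
    congr 1; omega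

/-- The block table as built by the machine (before the final identification with
`wBT (btab P F)`). [folklore] -/
def btOut (P : Params) (F : List (List (ℕ × Bool))) : List Γ' :=
  ((if (bList P F).length % bsz P = 0 then [] else [Γ'.blank]) ++ outS P F (bList P F) 0 []).reverse

section BtSpec2

variable (S : RStore) (P : Params) (F : List (List (ℕ × Bool))) (hB : BtBase S P F) (Lo : ℕ) (hLo : (wRecs (ocRecs F P.cap (occList F))).length ≤ Lo)
include hB hLo

/-- **The dictionary records of `ys`**, the variables `zs` done. [folklore] -/
theorem segRuns_bt_records : ∀ (ys zs rest : List ℕ), occList F = zs ++ ys ++ rest → ∀ (s5 more : List Γ'),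
    SegRuns (kr KR.s3) (btBody (bsz P)) (wRecs (dictRecs P F ys))
      (bSt S (wRecs (dictRecs P F ys) ++ more) [] [] s5 (List.replicate (cntB P F zs % bsz P) Γ'.blank) (szW (bsz P) (cntB P F zs)) [] [])
      (bSt S more [] [] (outS P F (ys.filter (inB P F)) (cntB P F zs) s5) (List.replicate (cntB P F (zs ++ ys) % bsz P) Γ'.blank)
        (szW (bsz P) (cntB P F (zs ++ ys))) [] [])
      (bK Lo (wRecs (dictRecs P F (occList F))).length (bsz P) (wFam F).length * ys.length + 5 * (wRecs (dictRecs P F ys)).length)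
  | [], zs, rest, _, s5, more => by
    simpa [wRecs, dictRecs, outS] using SegRuns.nil (kr KR.s3) (btBody (bsz P)) _
  | x :: ys, zs, rest, hocc, s5, more => by
    have hx : x ∈ occList F := by rw [hocc]; simp
    have h1 := segRuns_bt_record S P F hB Lo hLo x hx (cntB P F zs) s5 (wRecs (dictRecs P F ys) ++ more)
    have hcz : cntB P F zs + (if inB P F x then 1 else 0) = cntB P F (zs ++ [x]) := (cntB_append P F x).symm
    rw [hcz] at h1
    have h2 := segRuns_bt_records ys (zs ++ [x]) rest (by rw [hocc]; simp) (outS P F (if inB P F x then [x] else []) (cntB P F zs) s5) more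
    have := h1.append h2
    refine this.cast (by simp [wRecs, dictRecs]) (by simp [wRecs, dictRecs]) ?_ ?_
    · rw [List.filter_cons]
      cases hBx : inB P F x
      · have : cntB P F (zs ++ [x]) = cntB P F zs := by rw [← hcz, hBx]; simp
        simp [outS, this]
      · simp only [if_true]
        rw [show x :: List.filter (inB P F) ys = [x] ++ List.filter (inB P F) ys from rfl, outS_append, List.append_assoc]
        congr 2
        rw [← hcz, hBx]; simp
    · simp only [List.length_cons, wRecs, dictRecs, List.map_cons, List.flatMap_cons, List.length_append]; ring_nf; omega

omit hB in
/-- The forcing-table word of a variable is at most `(Lo + 6) |wFam F|` long. [folklore] -/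
theorem length_entries_le (z : ℕ) : ((entries P F z).flatMap wEntry).length ≤ (Lo + 6) * (wFam F).length := by
  have hocc : (occList F).length ≤ Lo := (length_le_wRecs F P.cap (occList F)).trans hLo
  unfold entries wFam
  rw [List.flatMap_map, List.length_flatMap, List.length_flatMap]
  calc ((F.filter (occursIn z)).map fun c => (wEntry (entryOf P F c z)).length).sum
      ≤ (F.map fun c => (wEntry (entryOf P F c z)).length).sum := by
        refine List.Sublist.sum_le_sum (List.filter_sublist.map _) (fun _ _ => Nat.zero_le _)
    _ ≤ (F.map fun c => (Lo + 6) * (KCNF.encodeClause c).length).sum := by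
        refine List.sum_le_sum (fun c _ => ?_)
        have hl : (cbody (aLits P F c z)).length ≤ (Lo + 2) * c.length := by
          unfold cbody aLits
          rw [List.length_flatMap, List.map_map]
          calc ((c.filter _).map _).sum ≤ ((c.filter fun l => l.1 != z && !inB P F l.1).map fun _ => Lo + 2).sum := by
                refine List.sum_le_sum (fun l _ => ?_)
                have ha : (encodeNat (newIdxA P F l.1)).length ≤ Lo := by
                  refine (TokConv.length_encodeNat_le _).trans ?_
                  unfold newIdxA
                  exact (List.idxOf_le_length).trans ((List.length_filter_le _ _).trans hocc)
                simp [encodeLiteral_eq, litBody]; omega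
            _ = (Lo + 2) * (c.filter fun l => l.1 != z && !inB P F l.1).length := by rw [List.map_const', List.sum_replicate, smul_eq_mul, Nat.mul_comm]
            _ ≤ (Lo + 2) * c.length := Nat.mul_le_mul_left _ (List.length_filter_le _ _)
        have hc : c.length + 2 ≤ (KCNF.encodeClause c).length := by
          simp only [KCNF.encodeClause, List.length_cons, List.length_append, List.length_flatMap, List.length_nil]
          have : c.length ≤ (c.map fun l => (KCNF.encodeLiteral l).length).sum := by
            calc c.length = (c.map fun _ => 1).sum := by simp
              _ ≤ _ := List.sum_le_sum (fun l _ => by simp [encodeLiteral_eq])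
          omega
        simp only [wEntry, entryOf, List.length_cons, List.length_append, List.length_nil]
        have h2 : (Lo + 2) * c.length + 4 ≤ (Lo + 6) * (c.length + 2) := by nlinarith
        have h3 : (Lo + 6) * (c.length + 2) ≤ (Lo + 6) * (KCNF.encodeClause c).length := Nat.mul_le_mul_left _ hc
        omega
    _ = (Lo + 6) * (F.map fun c => (KCNF.encodeClause c).length).sum := by rw [List.sum_map_mul_left]

omit hB in
/-- The output stack grows by at most `(Lo + 6) |wFam F| + 2` per `B`-variable. [folklore] -/
theorem length_outS_le : ∀ (bs : List ℕ) (t : ℕ) (acc : List Γ'), (outS P F bs t acc).length ≤ acc.length + bs.length * ((Lo + 6) * (wFam F).length + 2)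
  | [], t, acc => by simp [outS]
  | z :: bs, t, acc => by
    rw [outS]
    refine (length_outS_le bs _ _).trans ?_
    have := length_entries_le P F Lo hLo z
    split_ifs <;> simp only [List.length_append, List.length_cons, List.length_reverse, List.length_nil] <;> nlinarith

/-- The cost of the block-table builder. [folklore] -/
def btCost (Lo Ld m Wf : ℕ) : ℕ :=
  (10 * Ld + 3) + (bK Lo Ld m Wf * Lo + 5 * Ld + 1) + 4 + (2 * m + 1) + (3 * (Lo * ((Lo + 6) * Wf + 2) + 1) + 1)

/-- **Specification of `btBuild`.** [folklore] -/
theorem runs_btBuild (hs3 : S (kr KR.s3) = []) (hmd : S (kr KR.md) = []) (hpr : S (kr KR.pr) = []) (hs5 : S (kr KR.s5) = []) (hposc : S (kr KR.posc) = [])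
    (hszs : S (kr KR.szs) = []) (hpr2 : S (kr KR.pr2) = []) (hs6 : S (kr KR.s6) = []) (hbt : S (kr KR.bt) = []) :
    Runs (btBuild (bsz P)) S (Function.update (Function.update S (kr KR.szs) (szW (bsz P) (bList P F).length)) (kr KR.bt) (btOut P F))
      (btCost Lo (wRecs (dictRecs P F (occList F))).length (bsz P) (wFam F).length) := by
  set m := bsz P with hm
  have hm0 : 0 < m := bsz_pos P
  have hoccL : (occList F).length ≤ Lo := (length_le_wRecs F P.cap (occList F)).trans hLo
  have hLd := length_wRecs_dictRecs_le P F Lo hLo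
  have e0 : bSt S [] [] [] [] [] [] [] [] = S := by
    have e := bSt_eta S
    rw [hs3, hmd, hpr, hs5, hposc, hszs, hpr2, hs6] at e; exact e
  unfold btBuild
  have h0 := runs_copyToG (a := kr KR.dict) (b := kr KR.s3) (t₁ := kr KR.t1) (t₂ := kr KR.t2)
    (by simp) (by simp) (by simp) (by simp) (by simp) (by simp) (bSt S [] [] [] [] [] [] [] []) (by simp [hB.t1]) (by simp [hB.t2]) (by simp)
  rw [bSt_dict, hB.dict, update_bSt_s3] at h0
  have h1 := (segRuns_bt_records S P F hB Lo hLo (occList F) [] [] (by simp) [] []).runs_loop_nil (by simp)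
  simp only [List.append_nil, List.nil_append, cntB, List.filter_nil, List.length_nil, Nat.zero_mod, List.replicate_zero, szW] at h1
  rw [← bList] at h1
  set NB := (bList P F).length with hNB
  set out := outS P F (bList P F) 0 [] with hout
  -- the final blank of a partial block
  have h2 : Runs (ifTop (kr KR.posc) fun o => match o with
      | some _ => push (kr KR.s5) Γ'.blank
      | none => skip) (bSt S [] [] [] out (List.replicate (NB % m) Γ'.blank) (szW m NB) [] [])
      (bSt S [] [] [] ((if NB % m = 0 then [] else [Γ'.blank]) ++ out) (List.replicate (NB % m) Γ'.blank) (szW m NB) [] []) 4 := by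
    cases hr : NB % m with
    | zero =>
      rw [if_pos rfl, List.replicate_zero, List.nil_append]
      exact (Runs.ifTop_nil (R := bSt S [] [] [] out [] (szW m NB) [] []) (by simp) (Runs.skip _)).mono (by norm_num)
    | succ r =>
      rw [if_neg (Nat.succ_ne_zero _), List.replicate_succ]
      exact Runs.ifTop_cons (R := bSt S [] [] [] out (Γ'.blank :: List.replicate r Γ'.blank) (szW m NB) [] []) (x := Γ'.blank) (w := List.replicate r Γ'.blank) (by simp)
        (Runs.push' (by simp))
  have h3 := runs_clear (kr KR.posc) (bSt S [] [] [] ((if NB % m = 0 then [] else [Γ'.blank]) ++ out) (List.replicate (NB % m) Γ'.blank) (szW m NB) [] [])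
  rw [bSt_posc, update_bSt_posc, List.length_replicate] at h3
  have h4 := runs_pour (a := kr KR.s5) (b := kr KR.bt) (by simp) (bSt S [] [] [] ((if NB % m = 0 then [] else [Γ'.blank]) ++ out) [] (szW m NB) [] [])
  rw [bSt_s5, bSt_bt, hbt, List.append_nil, update_bSt_s5] at h4
  rw [e0] at h0
  refine (h0.seq (h1.seq (h2.seq (h3.seq h4)))).of_eq ?_ ?_
  · rw [btOut, ← hNB, ← hout]
    have e1 : bSt S [] [] [] [] [] (szW m NB) [] [] = Function.update S (kr KR.szs) (szW m NB) := by
      rw [← update_bSt_szs S [] [] [] [] [] [] [] [] (szW m NB), e0]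
    rw [e1]
  · have hol := length_outS_le P F Lo hLo (bList P F) 0 []
    have hNBL : NB ≤ Lo := (List.length_filter_le _ _).trans hoccL
    have hmod : NB % m < m := Nat.mod_lt _ hm0
    have hbk : bK Lo (wRecs (dictRecs P F (occList F))).length m (wFam F).length * (occList F).length ≤
        bK Lo (wRecs (dictRecs P F (occList F))).length m (wFam F).length * Lo := Nat.mul_le_mul_left _ hoccL
    have hlen : ((if NB % m = 0 then ([] : List Γ') else [Γ'.blank]) ++ out).length ≤ Lo * ((Lo + 6) * (wFam F).length + 2) + 1 := by
      have h1' : out.length ≤ Lo * ((Lo + 6) * (wFam F).length + 2) := by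
        rw [hout]; refine hol.trans ?_; simp only [List.length_nil, Nat.zero_add]; exact Nat.mul_le_mul_right _ hNBL
      split_ifs <;> simp <;> omega
    simp only [← hm] at *
    unfold btCost
    omega

end BtSpec2

/-! ### The machine's block table is `wBT (btab P F)`: chunks of the `B`-list -/

section Chunks

variable {α : Type}

/-- Consecutive chunks of length `m` (the last one possibly shorter; none if `m = 0`). [folklore] -/
def chunks (m : ℕ) : List α → List (List α)
  | [] => []
  | a :: l => match m with
    | 0 => []
    | k + 1 => (a :: l).take (k + 1) :: chunks m ((a :: l).drop (k + 1))
termination_by L => L.length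
decreasing_by simp only [List.drop_succ_cons, List.length_drop, List.length_cons]; omega

/-- Chunks of the empty list. [folklore] -/
@[simp] theorem chunks_nil (m : ℕ) : chunks m ([] : List α) = [] := by rw [chunks]

/-- Chunks of a nonempty list. [folklore] -/
theorem chunks_eq_cons (m : ℕ) (hm : 0 < m) (L : List α) (hL : L ≠ []) : chunks m L = L.take m :: chunks m (L.drop m) := by
  obtain ⟨a, l, rfl⟩ := List.exists_cons_of_ne_nil hL
  obtain ⟨k, rfl⟩ : ∃ k, m = k + 1 := ⟨m - 1, by omega⟩
  rw [chunks]

/-- **The chunks as slices.** [folklore] -/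
theorem chunks_eq_map_range (m : ℕ) (hm : 0 < m) : ∀ (n : ℕ) (L : List α), L.length ≤ n →
    chunks m L = (List.range ((L.length + m - 1) / m)).map fun i => (L.drop (i * m)).take m
  | 0, L, h => by
    have : L = [] := List.eq_nil_of_length_eq_zero (Nat.le_zero.1 h); subst this
    have e : (([] : List α).length + m - 1) / m = 0 := Nat.div_eq_of_lt (by simp; omega)
    rw [e]; simp
  | n + 1, L, h => by
    by_cases hL : L = []
    · subst hL
      have e : (([] : List α).length + m - 1) / m = 0 := Nat.div_eq_of_lt (by simp; omega)
      rw [e]; simp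
    have hpos := List.length_pos_iff.2 hL
    rw [chunks_eq_cons m hm L hL, chunks_eq_map_range m hm n (L.drop m) (by simp; omega)]
    have hq : (L.length + m - 1) / m = ((L.drop m).length + m - 1) / m + 1 := by
      rw [List.length_drop]
      by_cases hle : m ≤ L.length
      · rw [show L.length + m - 1 = (L.length - m + m - 1) + m by omega, Nat.add_div_right _ hm]
      · have e1 : (L.length + m - 1) / m = 1 := Nat.div_eq_of_lt_le (by omega) (by omega)
        have e2 : (L.length - m + m - 1) / m = 0 := Nat.div_eq_of_lt (by omega)
        rw [e1, e2]
    rw [hq, List.range_succ_eq_map, List.map_cons, List.map_map]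
    simp only [Nat.zero_mul, List.drop_zero, List.cons.injEq, true_and]
    refine List.map_congr_left fun i _ => ?_
    simp only [Function.comp_apply, List.drop_drop, Nat.succ_mul]
    rw [Nat.add_comm]

/-- The chunks concatenate to the list. [folklore] -/
theorem flatten_chunks (m : ℕ) (hm : 0 < m) : ∀ (n : ℕ) (L : List α), L.length ≤ n → (chunks m L).flatten = L
  | 0, L, h => by
    have : L = [] := List.eq_nil_of_length_eq_zero (Nat.le_zero.1 h); subst this; simp
  | n + 1, L, h => by
    by_cases hL : L = []
    · subst hL; simp
    rw [chunks_eq_cons m hm L hL, List.flatten_cons, flatten_chunks m hm n (L.drop m) (by simp; have := List.length_pos_iff.2 hL; omega),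
      List.take_append_drop]

/-- **The chunk lengths**: `|L| / m` full chunks, then the remainder if nonzero. [folklore] -/
theorem map_length_chunks (m : ℕ) (hm : 0 < m) : ∀ (n : ℕ) (L : List α), L.length ≤ n →
    (chunks m L).map List.length = List.replicate (L.length / m) m ++ (if L.length % m = 0 then [] else [L.length % m])
  | 0, L, h => by
    have : L = [] := List.eq_nil_of_length_eq_zero (Nat.le_zero.1 h); subst this; simp
  | n + 1, L, h => by
    by_cases hL : L = []
    · subst hL; simp
    have hpos := List.length_pos_iff.2 hL
    rw [chunks_eq_cons m hm L hL, List.map_cons]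
    by_cases hle : m ≤ L.length
    · rw [map_length_chunks m hm n (L.drop m) (by simp; omega), List.length_take, List.length_drop]
      have e1 : L.length / m = (L.length - m) / m + 1 := by
        conv_lhs => rw [show L.length = L.length - m + m by omega, Nat.add_div_right _ hm]
      have e2 : L.length % m = (L.length - m) % m := by
        conv_lhs => rw [show L.length = L.length - m + m by omega, Nat.add_mod_right]
      rw [min_eq_left hle, e1, e2, List.replicate_succ, List.cons_append]
    · rw [not_le] at hle
      rw [List.drop_eq_nil_iff.2 hle.le, chunks_nil, List.map_nil, List.length_take, min_eq_right hle.le, Nat.div_eq_of_lt hle,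
        Nat.mod_eq_of_lt hle, List.replicate_zero, List.nil_append, if_neg (by omega : L.length ≠ 0)]

/-- The successor modulo `m`. [folklore] -/
theorem succ_mod_eq' (t m : ℕ) (hm : 0 < m) : (t + 1) % m = if t % m + 1 = m then 0 else t % m + 1 := by
  have hlt : t % m < m := Nat.mod_lt _ hm
  split_ifs with h
  · have hd := Nat.div_add_mod t m
    have : t + 1 = (t / m + 1) * m := by rw [Nat.succ_mul, Nat.mul_comm]; omega
    rw [this, Nat.mul_mod_left]
  · have : t + 1 = t / m * m + (t % m + 1) := by have := Nat.div_add_mod t m; rw [Nat.mul_comm]; omega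
    rw [this, Nat.mul_add_mod', Nat.mod_eq_of_lt (by omega)]

end Chunks

section BTab

variable (P : Params) (F : List (List (ℕ × Bool)))

/-- The nonempty blocks are the chunks of the `B`-list. [folklore] -/
theorem map_block_eq_chunks : (List.range (numNB P F)).map (block P F) = chunks (bsz P) (bList P F) := by
  rw [chunks_eq_map_range (bsz P) (bsz_pos P) _ _ le_rfl]; rfl

/-- The table word of one `B`-variable. [folklore] -/
def wv (z : ℕ) : List Γ' := (entries P F z).flatMap wEntry ++ [Γ'.bra]

/-- **The block table word over the chunks of the `B`-list.** [folklore] -/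
theorem wBT_btab : wBT (btab P F) = (chunks (bsz P) (bList P F)).flatMap fun C => C.flatMap (wv P F) ++ [Γ'.blank] := by
  unfold wBT btab
  rw [show (List.range (numNB P F)).map (fun i => (block P F i).map (entries P F)) = ((List.range (numNB P F)).map (block P F)).map (List.map (entries P F))
    by rw [List.map_map]; rfl, map_block_eq_chunks, List.flatMap_map]
  refine List.flatMap_congr fun C _ => ?_
  simp only [wBlock, wVar, List.flatMap_map]
  rfl

/-- `outS` over a partial chunk (at most `m - r` variables when the counter is at `r` modulo `m`).
[folklore] -/
theorem outS_small : ∀ (C : List ℕ) (t : ℕ) (acc : List Γ'), t % bsz P + C.length ≤ bsz P →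
    outS P F C t acc = (if t % bsz P + C.length = bsz P then [Γ'.blank] else []) ++ (C.flatMap (wv P F)).reverse ++ acc
  | [], t, acc, h => by
    have : t % bsz P < bsz P := Nat.mod_lt _ (bsz_pos P)
    rw [outS, if_neg (by simp; omega)]; simp
  | z :: C, t, acc, h => by
    have hm := bsz_pos P
    rw [outS, succ_mod_eq' t (bsz P) hm]
    simp only [List.length_cons] at h
    by_cases hr : t % bsz P + 1 = bsz P
    · have hC : C = [] := by
        rcases C with _ | ⟨y, C⟩; · rfl
        · simp at h; omega
      subst hC
      rw [if_pos hr, outS]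
      simp [hr, wv, List.reverse_append]
    · rw [if_neg hr, if_neg (by omega), List.nil_append, outS_small C (t + 1) _ (by rw [succ_mod_eq' t _ hm, if_neg hr]; omega),
        succ_mod_eq' t _ hm, if_neg hr]
      simp only [List.length_cons, List.flatMap_cons, List.reverse_append, List.append_assoc]
      have e : (t % bsz P + 1 + C.length = bsz P) ↔ (t % bsz P + (C.length + 1) = bsz P) := by omega
      simp only [e, wv, List.reverse_append, List.reverse_cons, List.reverse_nil, List.nil_append, List.cons_append]

end BTab

section BTab2

variable (P : Params) (F : List (List (ℕ × Bool)))

/-- The word of the chunks with a blank after every FULL chunk. [folklore] -/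
def chunkW (L : List ℕ) : List Γ' :=
  (chunks (bsz P) L).flatMap fun C => C.flatMap (wv P F) ++ (if C.length = bsz P then [Γ'.blank] else [])

/-- **`outS` from a block boundary** emits the chunk word. [folklore] -/
theorem outS_chunks : ∀ (n : ℕ) (L : List ℕ), L.length ≤ n → ∀ (t : ℕ) (acc : List Γ'), t % bsz P = 0 →
    outS P F L t acc = (chunkW P F L).reverse ++ acc
  | 0, L, h, t, acc, _ => by
    have : L = [] := List.eq_nil_of_length_eq_zero (Nat.le_zero.1 h); subst this; simp [outS, chunkW]
  | n + 1, L, h, t, acc, ht => by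
    have hm := bsz_pos P
    by_cases hL : L = []
    · subst hL; simp [outS, chunkW]
    rw [chunkW, chunks_eq_cons (bsz P) hm L hL, List.flatMap_cons, ← chunkW]
    by_cases hshort : L.length ≤ bsz P
    · have hdrop : L.drop (bsz P) = [] := List.drop_eq_nil_iff.2 hshort
      rw [hdrop, List.take_of_length_le hshort, outS_small P F L t acc (by rw [ht]; simpa using hshort), ht, Nat.zero_add]
      simp only [chunkW, chunks_nil, List.flatMap_nil, List.append_nil, List.reverse_append]
      split_ifs <;> simp
    · have hlen : (L.take (bsz P)).length = bsz P := by rw [List.length_take]; omega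
      conv_lhs => rw [← List.take_append_drop (bsz P) L]
      rw [outS_append, outS_small P F (L.take (bsz P)) t acc (by rw [ht, hlen]; simp), hlen,
        outS_chunks n (L.drop (bsz P)) (by simp; omega) (t + bsz P) _ (by rw [Nat.add_mod, ht]; simp), ht, Nat.zero_add]
      simp [List.reverse_append]

/-- The last chunk is full iff `m` divides the length. [folklore] -/
theorem chunkW_append_final : ∀ (n : ℕ) (L : List ℕ), L.length ≤ n →
    chunkW P F L ++ (if L.length % bsz P = 0 then [] else [Γ'.blank]) = (chunks (bsz P) L).flatMap fun C => C.flatMap (wv P F) ++ [Γ'.blank]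
  | 0, L, h => by
    have : L = [] := List.eq_nil_of_length_eq_zero (Nat.le_zero.1 h); subst this; simp [chunkW]
  | n + 1, L, h => by
    have hm := bsz_pos P
    by_cases hL : L = []
    · subst hL; simp [chunkW]
    have hpos := List.length_pos_iff.2 hL
    rw [chunkW, chunks_eq_cons (bsz P) hm L hL, List.flatMap_cons, List.flatMap_cons, ← chunkW]
    by_cases hshort : L.length ≤ bsz P
    · have hdrop : L.drop (bsz P) = [] := List.drop_eq_nil_iff.2 hshort
      rw [hdrop, List.take_of_length_le hshort]
      simp only [chunks_nil, List.flatMap_nil, List.append_nil, chunkW]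
      by_cases he : L.length = bsz P
      · rw [if_pos he, if_pos (by rw [he, Nat.mod_self])]; simp
      · rw [if_neg he, if_neg (by rw [Nat.mod_eq_of_lt (by omega)]; omega)]; simp
    · have hlen : (L.take (bsz P)).length = bsz P := by rw [List.length_take]; omega
      rw [hlen, if_pos rfl, List.append_assoc]
      have ih' := chunkW_append_final n (L.drop (bsz P)) (by simp; omega)
      have hmod : (L.drop (bsz P)).length % bsz P = L.length % bsz P := by
        rw [List.length_drop]
        conv_rhs => rw [show L.length = L.length - bsz P + bsz P by omega, Nat.add_mod_right]
      rw [hmod] at ih'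
      rw [ih']

/-- **The machine's block table is the block table.** [folklore] -/
theorem btOut_eq : btOut P F = wBT (btab P F) := by
  rw [btOut, outS_chunks P F _ (bList P F) le_rfl 0 [] (Nat.zero_mod _), List.append_nil, List.reverse_append, List.reverse_reverse,
    wBT_btab, ← chunkW_append_final P F _ (bList P F) le_rfl]
  split_ifs <;> simp

/-- `szW` in closed form. [folklore] -/
theorem szW_closed (m : ℕ) (hm : 0 < m) : ∀ n : ℕ,
    szW m n = (if n % m = 0 then [] else List.replicate (n % m) Γ'.blank ++ [Γ'.comma]) ++ (List.replicate (n / m) (List.replicate m Γ'.blank ++ [Γ'.comma])).flatten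
  | 0 => by simp [szW, Nat.zero_div, Nat.zero_mod]
  | n + 1 => by
    rw [szW, szW_closed m hm n, succ_mod_eq' n m hm]
    have hlt : n % m < m := Nat.mod_lt _ hm
    have hdm := Nat.div_add_mod n m
    by_cases h0 : n % m = 0
    · rw [if_pos h0, if_pos h0]
      by_cases h1 : n % m + 1 = m
      · -- `m = 1`
        have hm1 : m = 1 := by omega
        subst hm1
        simp [Nat.mod_one, List.replicate_succ]
      · rw [if_neg h1, if_neg (by omega), h0]
        have : (n + 1) / m = n / m := by
          rw [Nat.succ_div, if_neg ?_]; · rfl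
          intro hd; have := Nat.mod_eq_zero_of_dvd hd; rw [succ_mod_eq' n m hm, if_neg h1] at this; omega
        rw [this]; simp
    · rw [if_neg h0]
      by_cases h1 : n % m + 1 = m
      · rw [if_pos h1, if_pos rfl]
        have : (n + 1) / m = n / m + 1 := by
          rw [Nat.succ_div, if_pos ?_]
          exact Nat.dvd_of_mod_eq_zero (by rw [succ_mod_eq' n m hm, if_pos h1])
        rw [this, List.replicate_succ, List.flatten_cons, List.nil_append]
        have hrep : List.replicate m Γ'.blank = Γ'.blank :: List.replicate (n % m) Γ'.blank := by
          conv_lhs => rw [← h1, List.replicate_succ]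
        rw [hrep, if_neg h0]; simp
      · rw [if_neg h1, if_neg (by omega)]
        have : (n + 1) / m = n / m := by
          rw [Nat.succ_div, if_neg ?_]; · rfl
          intro hd; have := Nat.mod_eq_zero_of_dvd hd; rw [succ_mod_eq' n m hm, if_neg h1] at this; omega
        rw [this, if_neg (by omega : n % m + 1 ≠ 0)]; simp [List.replicate_succ, List.append_assoc]

/-- **The size digits are the sizes of the nonempty blocks**, last block first. [folklore] -/
theorem szW_eq_chunks (L : List ℕ) :
    szW (bsz P) L.length = ((chunks (bsz P) L).map fun C => List.replicate C.length Γ'.blank ++ [Γ'.comma]).reverse.flatten := by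
  have hm := bsz_pos P
  rw [szW_closed (bsz P) hm, show ((chunks (bsz P) L).map fun C => List.replicate C.length Γ'.blank ++ [Γ'.comma]) =
      ((chunks (bsz P) L).map List.length).map (fun s => List.replicate s Γ'.blank ++ [Γ'.comma]) by rw [List.map_map]; rfl,
    map_length_chunks (bsz P) hm _ L le_rfl, List.map_append, List.reverse_append, List.flatten_append]
  congr 1
  · split_ifs <;> simp
  · rw [List.map_replicate, List.reverse_replicate]

end BTab2

end Literature.Computability.FineGrained.IPRenameM
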